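import Literature.NumberTheory.LFunctions.RodgersTaoZeroDynamics
import HarnessLib

/-!
# Rodgers–Tao 2020, Theorem 11 (= Thm. 4.1) and Lemma 12 (i)–(v) discharged: the ODE of the zeros

RH-FREE LITERATURE — proofs only (no definitions, no named facts). Trunk T-ANT
(`Literature/NumberTheory/LFunctions`). Companion of `RodgersTaoZeroDynamics.lean`, which types
§4 of B. Rodgers, T. Tao, *The de Bruijn–Newman constant is non-negative*, Forum Math. Pi 8 (2020)
e6 (Thm. 11 p. 27 = arXiv:1801.05914v4 Thm. 4.1; Lemma 12 pp. 29–30 = Lemma 4.2). This file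
DISCHARGES the named fact `rodgers_tao_zero_dynamics` (Theorem 11: for `Λ < t` the zeros `x_k(t)`,
`k ∈ ℤ*`, are `C¹` in `t` and `∂ₜ x_k = 2 Σ'_{j ≠ k} 1/(x_k − x_j)`, the principal value sum
converging) as `rodgers_tao_zero_dynamics_holds`, and the named fact `rodgers_tao_gap_dynamics`
(Lemma 12 (i):
`∂ₜ(x_k − x_j) = 4/(x_k − x_j) − 2(x_k − x_j) Σ_{i ≠ k,j} 1/((x_i − x_k)(x_i − x_j))`, the series
converging absolutely) as `rodgers_tao_gap_dynamics_holds` — CONTENT discharges: the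
typed facts have no `Λ < 0` antecedent and the proofs below formalise the derivations, they do not
argue ex falso. Nothing here bears on the truth of the Riemann hypothesis.

## The printed proof and this formalisation

The source (p. 27): "This follows from [CSV, Lemma 2.4] (the continuity of the derivative
following for instance from [CSV, Lemma 2.1])", i.e. Csordas–Smith–Varga 1994 differentiate the
identity `H_t(x_k(t)) = 0` implicitly, use the backwards heat equation `∂ₜ H_t = −H_t''`, and read
`H_t''(x_k)/H_t'(x_k)` off the Hadamard product of `H_t`. The same three steps are carried out here
against the tree's infrastructure:

1. **Implicit differentiation** (`hasDerivAt_of_implicit`, elementary: two mean value theorems and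
   the joint continuity of the partial derivatives; `hasDerivAt_deBruijnZeroZ`): since
   `(s, x) ↦ Re H_s(x)` has the jointly continuous partials `Re H_s'(x)`
   (`continuous_re_deriv_deBruijnH_uncurry`) and `Re ∂ₛH_s(x) = Re C₂(s, x)`
   (`hasDerivAt_deBruijnH_time`, `continuous_cosMoment_uncurry`), and `s ↦ x_k(s)` is continuous
   (`continuousAt_deBruijnZero`, the tree's continuity half of Thm. 11) with `H_s(x_k(s)) = 0` and
   `H_t'(x_k(t)) ≠ 0` (Csordas–Smith–Varga simplicity, `csordasSmithVarga_simple_zeros_holds`),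
   `∂ₜ x_k(t) = −Re ∂ₜH_t(x_k)/Re H_t'(x_k) = H_t''(x_k)/H_t'(x_k)`; this velocity is continuous in
   `t`, whence `C¹` (`contDiffAt_deBruijnZeroZ`).
2. **The Hadamard product over the enumerated zeros** (`isHadamardSeq_deBruijnZero`): for `t > Λ`
   the genus-`0` product `H_t(z) = H_t(0) ∏_n (1 + b_n z²)` of the tree (`exists_isHadamardSeq`,
   Polymath 15 §3) is re-indexed by the real simple zeros: `c_j := −1/x_{j+1}(t)²` is again a
   Hadamard sequence (each `x_{j+1}` kills exactly one factor,
   `IsHadamardSeq.mult_eq_one_of_deriv_ne_zero`; distinct zeros kill distinct factors; a factor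
   killed by no `x_j` is trivial since every zero is some `±x_j`). In particular
   `Σ_j 1/x_j(t)² < ∞` (`summable_inv_deBruijnZero_sq`).
3. **The equation of motion** (`velocity_eq_two_mul_series`): at the simple zero `x_k`,
   `H_t = (w − x_k) Q(w)` gives `H_t'(x_k) = Q(x_k)`, `H_t''(x_k) = 2Q'(x_k)`
   (`IsHadamardSeq.deriv_eq_cofactor_of_mult_eq_one`), and the tree's regularised logarithmic
   derivative `Q'/Q(x_k) = 1/(2x_k) + Σ_j 2c_j x_k/(1 + c_j x_k²)`
   (`IsHadamardSeq.logDeriv_cofactor_self`) reads `1/(2x_k) + Σ_{m ≥ 1} 2x_k/(x_k² − x_m²)`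
   (`hadamard_term_eq`; the term `m = |k|` is `0`), while the principal value partial sums are
   `Σ_{j ∈ [−J,J]_{ℤ*}, j ≠ k} 1/(x_k − x_j) = 1/(2x_k) + Σ_{m ≤ J} 2x_k/(x_k² − x_m²)` for
   `J ≥ |k|` (`zeroVelocityPartialSum_eq_sum`: pair `j = ±m`, the term `j = −k` being
   `1/(2x_k)`), so they converge (`tendsto_zeroVelocityPartialSum`) and
   `∂ₜ x_k = 2 Σ'_{j ≠ k} 1/(x_k − x_j)` (`hasDerivAt_deBruijnZeroZ_velocitySum`).

4. **Lemma 12 (i)** (source p. 31: "From (56) one has `∂ₜx_k − ∂ₜx_j = …` which gives (i).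
   Note that the series is now absolutely convergent"): subtract the two equations of motion,
   rearrange the truncated principal value sums over `[−J, J]_{ℤ*}`
   (`zeroVelocityPartialSum_sub`: `= 2/(x_k − x_j) − (x_k − x_j) Σ_{i ∈ [−J,J]_{ℤ*} ∖ {k,j}} ⋯`),
   and let `J → ∞` (`tendsto_sum_rodgersTaoCrossTerm`), the cross terms being absolutely summable
   over `ℤ` by comparison with `4/x_i²` (`summable_rodgersTaoCrossTerm_int`, using `x_n → ∞`,
   `tendsto_deBruijnZero_atTop`).

Everything is stated for every `t > Λ` in the tree's `sInf`-free form (`H_{t₁}` real-rooted for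
some `t₁ < t`), the typed range of `RodgersTaoZeroDynamics.lean`.

## References

* B. Rodgers, T. Tao, *The de Bruijn–Newman constant is non-negative*, Forum Math. Pi 8 (2020)
  e6, §1.2 p. 7, Thm. 11 p. 27 (56), Lemma 12 (i)–(v) pp. 29–30 with proofs pp. 31–33
  (= arXiv:1801.05914 Thm. 4.1, Lemma 4.2); the later filings (v)/(iv), (iii), (ii) are
  introduced by their own section docstrings below.
* G. Csordas, W. Smith, R. S. Varga, *Lehmer pairs of zeros, the de Bruijn–Newman constant `Λ`,
  and the Riemann Hypothesis*, Constr. Approx. 10 (1994), 107–129, Lemmas 2.1, 2.4 (as cited by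
  the source).
* D. H. J. Polymath, *Effective approximation of heat flow evolution of the Riemann `ξ` function,
  and a new upper bound for the de Bruijn–Newman constant*, Res. Math. Sci. 6 (2019), §3 (the
  Hadamard product and `H_t'/H_t`, as formalised in `DeBruijnHLogDerivSeries.lean`).
-/

noncomputable section

open Filter Set Topology

namespace Literature.NumberTheory.LFunctions

/-! ## Implicit differentiation along the zero curves -/

/-- **Implicit differentiation along a continuous branch of zeros** (one real space dimension).
If `F(s, x)` has partial derivatives `Fs`, `Fx` everywhere, `Fx` and `Fs` are jointly continuous at
`(t, g t)`, `g` is continuous at `t` with `F(s, g s) = 0` near `t`, and `Fx(t, g t) ≠ 0`, then `g`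
is differentiable at `t` with `g'(t) = −Fs(t, g t)/Fx(t, g t)` (two applications of the mean
value theorem; the implicit differentiation behind Csordas–Smith–Varga's Lemma 2.4 as invoked by
the source). [cite: RodgersTaoFMP2020, Thm. 11 p. 27 (proof)] -/
theorem hasDerivAt_of_implicit {F Fs Fx : ℝ → ℝ → ℝ} {g : ℝ → ℝ} {t : ℝ}
    (hFx : ∀ s x, HasDerivAt (fun x ↦ F s x) (Fx s x) x)
    (hFs : ∀ s x, HasDerivAt (fun s ↦ F s x) (Fs s x) s)
    (hcx : ContinuousAt (fun p : ℝ × ℝ ↦ Fx p.1 p.2) (t, g t))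
    (hcs : ContinuousAt (fun p : ℝ × ℝ ↦ Fs p.1 p.2) (t, g t))
    (hg : ContinuousAt g t) (hzero : ∀ᶠ s in 𝓝 t, F s (g s) = 0) (hne : Fx t (g t) ≠ 0) :
    HasDerivAt g (-Fs t (g t) / Fx t (g t)) t := by
  rw [hasDerivAt_iff_tendsto_slope, Metric.tendsto_nhdsWithin_nhds]
  intro ε hε
  set Φ : ℝ × ℝ × ℝ → ℝ := fun p ↦ -Fs p.1 p.2.1 / Fx t p.2.2 with hΦ
  have hΦc : ContinuousAt Φ (t, g t, g t) := by
    have h1 : ContinuousAt (fun p : ℝ × ℝ × ℝ ↦ Fs p.1 p.2.1) (t, g t, g t) :=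
      ContinuousAt.comp_of_eq (f := fun p : ℝ × ℝ × ℝ ↦ (p.1, p.2.1)) hcs
        (by fun_prop : Continuous fun p : ℝ × ℝ × ℝ ↦ (p.1, p.2.1)).continuousAt rfl
    have h2 : ContinuousAt (fun p : ℝ × ℝ × ℝ ↦ Fx t p.2.2) (t, g t, g t) :=
      ContinuousAt.comp_of_eq (f := fun p : ℝ × ℝ × ℝ ↦ (t, p.2.2)) hcx
        (by fun_prop : Continuous fun p : ℝ × ℝ × ℝ ↦ (t, p.2.2)).continuousAt rfl
    exact h1.neg.div h2 hne
  obtain ⟨δ₁, hδ₁, hΦδ⟩ := Metric.continuousAt_iff.1 hΦc ε hε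
  have hcx1 : ContinuousAt (fun η ↦ Fx t η) (g t) :=
    ContinuousAt.comp_of_eq (f := fun η : ℝ ↦ (t, η)) hcx
      (by fun_prop : Continuous fun η : ℝ ↦ (t, η)).continuousAt rfl
  obtain ⟨δ₂, hδ₂, hne'⟩ : ∃ δ₂ > 0, ∀ ⦃η : ℝ⦄, dist η (g t) < δ₂ → Fx t η ≠ 0 :=
    Metric.eventually_nhds_iff.1 (hcx1.eventually_ne hne)
  obtain ⟨δ₃, hδ₃, hgδ⟩ := Metric.continuousAt_iff.1 hg (min δ₁ δ₂) (lt_min hδ₁ hδ₂)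
  obtain ⟨δ₄, hδ₄, hzδ⟩ := Metric.eventually_nhds_iff.1 hzero
  have hz0 : F t (g t) = 0 := hzδ (by rw [dist_self]; exact hδ₄)
  refine ⟨min δ₁ (min δ₃ δ₄), lt_min hδ₁ (lt_min hδ₃ hδ₄), fun s hs hsd ↦ ?_⟩
  have hst : s ≠ t := hs
  have hs1 : dist s t < δ₁ := lt_of_lt_of_le hsd (min_le_left _ _)
  have hs3 : dist s t < δ₃ := lt_of_lt_of_le hsd ((min_le_right _ _).trans (min_le_left _ _))
  have hs4 : dist s t < δ₄ := lt_of_lt_of_le hsd ((min_le_right _ _).trans (min_le_right _ _))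
  have hgs : dist (g s) (g t) < min δ₁ δ₂ := hgδ hs3
  have hzs : F s (g s) = 0 := hzδ hs4
  -- mean value theorem in time, at the frozen position `g s`
  obtain ⟨c, hc, hcslope⟩ :
      ∃ c : ℝ, dist c t < dist s t ∧ F s (g s) - F t (g s) = (s - t) * Fs c (g s) := by
    rcases lt_or_gt_of_ne hst with hlt | hlt
    · obtain ⟨c, hc, hc'⟩ := exists_hasDerivAt_eq_slope (fun σ ↦ F σ (g s)) (fun σ ↦ Fs σ (g s))
        hlt (fun σ _ ↦ (hFs σ (g s)).continuousAt.continuousWithinAt) (fun σ _ ↦ hFs σ (g s))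
      refine ⟨c, ?_, ?_⟩
      · rw [Real.dist_eq, Real.dist_eq, abs_of_neg (by linarith [hc.2]), abs_of_neg (by linarith)]
        linarith [hc.1]
      · rw [eq_div_iff (sub_ne_zero.2 hst.symm)] at hc'
        linear_combination hc'
    · obtain ⟨c, hc, hc'⟩ := exists_hasDerivAt_eq_slope (fun σ ↦ F σ (g s)) (fun σ ↦ Fs σ (g s))
        hlt (fun σ _ ↦ (hFs σ (g s)).continuousAt.continuousWithinAt) (fun σ _ ↦ hFs σ (g s))
      refine ⟨c, ?_, ?_⟩
      · rw [Real.dist_eq, Real.dist_eq, abs_of_pos (by linarith [hc.1]), abs_of_pos (by linarith)]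
        linarith [hc.2]
      · rw [eq_div_iff (sub_ne_zero.2 hst)] at hc'
        linear_combination -hc'
  -- mean value theorem in space, at the frozen time `t`
  obtain ⟨η, hη, hηslope⟩ :
      ∃ η : ℝ, dist η (g t) ≤ dist (g s) (g t) ∧ F t (g s) - F t (g t) = (g s - g t) * Fx t η := by
    rcases lt_trichotomy (g s) (g t) with hlt | heq | hgt
    · obtain ⟨η, hη, hη'⟩ := exists_hasDerivAt_eq_slope (fun x ↦ F t x) (fun x ↦ Fx t x)
        hlt (fun x _ ↦ (hFx t x).continuousAt.continuousWithinAt) (fun x _ ↦ hFx t x)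
      refine ⟨η, ?_, ?_⟩
      · rw [Real.dist_eq, Real.dist_eq, abs_of_neg (by linarith [hη.2]), abs_of_neg (by linarith)]
        linarith [hη.1]
      · rw [eq_div_iff (sub_ne_zero.2 hlt.ne')] at hη'
        linear_combination hη'
    · exact ⟨g t, by rw [dist_self]; exact dist_nonneg, by rw [heq]; ring⟩
    · obtain ⟨η, hη, hη'⟩ := exists_hasDerivAt_eq_slope (fun x ↦ F t x) (fun x ↦ Fx t x)
        hgt (fun x _ ↦ (hFx t x).continuousAt.continuousWithinAt) (fun x _ ↦ hFx t x)
      refine ⟨η, ?_, ?_⟩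
      · rw [Real.dist_eq, Real.dist_eq, abs_of_pos (by linarith [hη.1]), abs_of_pos (by linarith)]
        linarith [hη.2]
      · rw [eq_div_iff (sub_ne_zero.2 hgt.ne')] at hη'
        linear_combination -hη'
  have hηne : Fx t η ≠ 0 := hne' (lt_of_le_of_lt hη (lt_of_lt_of_le hgs (min_le_right _ _)))
  -- the slope is `Φ (c, g s, η)`
  have hslope : slope g t s = Φ (c, g s, η) := by
    rw [slope_def_field]
    show (g s - g t) / (s - t) = -Fs c (g s) / Fx t η
    rw [hzs, zero_sub] at hcslope
    rw [hz0, sub_zero] at hηslope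
    have hst' : s - t ≠ 0 := sub_ne_zero.2 hst
    rw [div_eq_div_iff hst' hηne]
    linear_combination -hηslope - hcslope
  rw [hslope]
  have hdist : dist (c, g s, η) (t, g t, g t) < δ₁ := by
    rw [Prod.dist_eq, Prod.dist_eq]
    refine max_lt (hc.trans hs1) (max_lt (lt_of_lt_of_le hgs (min_le_left _ _)) ?_)
    exact lt_of_le_of_lt hη (lt_of_lt_of_le hgs (min_le_left _ _))
  exact hΦδ hdist

/-- `∂ₛ Re H_s(x) = Re C₂(s, x)` for real `x` (the backwards heat equation
`hasDerivAt_deBruijnH_time`, real part). [cite: Polymath2019, §3, eq. (back)] -/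
theorem hasDerivAt_re_deBruijnH_time (s x : ℝ) :
    HasDerivAt (fun s : ℝ ↦ (deBruijnH s x).re) (cosMoment 2 s x).re s := by
  have h := (Complex.reCLM.hasFDerivAt).comp_hasDerivAt s (hasDerivAt_deBruijnH_time s (x : ℂ))
  simpa [Function.comp_def] using h

/-- Joint continuity of `(s, x) ↦ Re C₂(s, x)` on `ℝ × ℝ` (from `continuous_cosMoment_uncurry`).
[cite: Polymath2019, §3] -/
theorem continuous_re_cosMoment_two_uncurry :
    Continuous fun p : ℝ × ℝ ↦ (cosMoment 2 p.1 p.2).re :=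
  Complex.continuous_re.comp ((continuous_cosMoment_uncurry 2).comp
    (continuous_fst.prodMk (Complex.continuous_ofReal.comp continuous_snd)))

/-- `Re H_t'(x_k(t)) ≠ 0` for `k ∈ ℤ*`, `t > Λ` (the zeros are simple and `H_t'` is real on `ℝ`).
[cite: RodgersTaoFMP2020, §1.2 p. 7] -/
theorem re_deriv_deBruijnH_deBruijnZeroZ_ne_zero {t : ℝ}
    (hΛ : ∃ t₁ : ℝ, t₁ < t ∧ HasOnlyRealZeros (deBruijnH t₁)) {k : ℤ} (hk : k ≠ 0) :
    (deriv (deBruijnH t) (deBruijnZeroZ t k)).re ≠ 0 := fun h ↦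
  deriv_deBruijnH_deBruijnZeroZ_ne_zero hΛ hk
    (Complex.ext h (deriv_deBruijnH_ofReal_im t (deBruijnZeroZ t k)))

/-- **Differentiability of the zeros in `t` with the implicit-function formula**:
`∂ₜ x_k(t) = −Re ∂ₜH_t(x_k) / Re H_t'(x_k) = −Re C₂(t, x_k(t)) / Re H_t'(x_k(t))` for `t > Λ`,
`k ∈ ℤ*`. [cite: RodgersTaoFMP2020, Thm. 11 p. 27] -/
theorem hasDerivAt_deBruijnZeroZ {t : ℝ} (hΛ : ∃ t₁ : ℝ, t₁ < t ∧ HasOnlyRealZeros (deBruijnH t₁))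
    {k : ℤ} (hk : k ≠ 0) :
    HasDerivAt (fun s ↦ deBruijnZeroZ s k)
      (-(cosMoment 2 t (deBruijnZeroZ t k)).re /
        (deriv (deBruijnH t) (deBruijnZeroZ t k)).re) t := by
  obtain ⟨t₁, ht₁, hreal⟩ := hΛ
  have hΛ : ∃ t₁ : ℝ, t₁ < t ∧ HasOnlyRealZeros (deBruijnH t₁) := ⟨t₁, ht₁, hreal⟩
  refine hasDerivAt_of_implicit (F := fun s x ↦ (deBruijnH s x).re)
    (Fs := fun s x ↦ (cosMoment 2 s x).re) (Fx := fun s x ↦ (deriv (deBruijnH s) x).re)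
    (g := fun s ↦ deBruijnZeroZ s k) (fun s x ↦ hasDerivAt_re_deBruijnH s x)
    (fun s x ↦ hasDerivAt_re_deBruijnH_time s x)
    continuous_re_deriv_deBruijnH_uncurry.continuousAt
    continuous_re_cosMoment_two_uncurry.continuousAt (continuousAt_deBruijnZeroZ hΛ k) ?_
    (re_deriv_deBruijnH_deBruijnZeroZ_ne_zero hΛ hk)
  filter_upwards [lt_mem_nhds ht₁] with s hs
  simp only [deBruijnH_deBruijnZeroZ ⟨t₁, hs, hreal⟩ hk, Complex.zero_re]

/-! ## The Hadamard product of `H_t` over its enumerated zeros -/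

namespace IsHadamardSeq

variable {t : ℝ} {b : ℕ → ℂ}

/-- At a simple zero of `H_t` the Hadamard multiplicity is `1` (the multiplicity is the analytic
order, `analyticOrderAt_eq_mult`). [cite: Polymath2019, §3] -/
theorem mult_eq_one_of_deriv_ne_zero (h : IsHadamardSeq t b) {z₁ : ℂ} (hz₁ : deBruijnH t z₁ = 0)
    (hd : deriv (deBruijnH t) z₁ ≠ 0) : h.mult z₁ = 1 := by
  have h1 := h.mult_pos hz₁
  have h2 : ¬ (2 : ℕ∞) ≤ analyticOrderAt (deBruijnH t) z₁ := fun hle ↦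
    hd ((two_le_analyticOrderAt_deBruijnH_iff differentiable_deBruijnH_holds t z₁).1 hle).2
  rw [h.analyticOrderAt_eq_mult hz₁] at h2
  have h3 : h.mult z₁ < 2 := by
    by_contra hge
    exact h2 (by exact_mod_cast not_lt.1 hge)
  omega

/-- At a simple zero `z₁` of `H_t` (multiplicity `1`), with cofactor `Q` (`H_t(w) = (w − z₁) Q(w)`):
`H_t'(z₁) = Q(z₁)` and `H_t''(z₁) = 2 Q'(z₁)`. [cite: Polymath2019, §3] -/
theorem deriv_eq_cofactor_of_mult_eq_one (h : IsHadamardSeq t b) {z₁ : ℂ}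
    (hz₁ : deBruijnH t z₁ = 0) (hm : h.mult z₁ = 1) :
    deriv (deBruijnH t) z₁ = h.cofactor z₁ z₁ ∧
      deriv (deriv (deBruijnH t)) z₁ = 2 * deriv (h.cofactor z₁) z₁ := by
  set Q := h.cofactor z₁ with hQ
  have hQd : Differentiable ℂ Q := h.differentiable_cofactor z₁
  have hQ'd : Differentiable ℂ (deriv Q) := fun w ↦ ((hQd.analyticAt w).deriv).differentiableAt
  have hH : deBruijnH t = fun w ↦ (w - z₁) * Q w := by
    funext w
    rw [h.eq_pow_mul_cofactor hz₁ w, hm, pow_one]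
  have hH' : deriv (deBruijnH t) = fun w ↦ Q w + (w - z₁) * deriv Q w := by
    funext w
    rw [hH]
    have hd : HasDerivAt (fun w ↦ (w - z₁) * Q w) (1 * Q w + (w - z₁) * deriv Q w) w := by
      exact ((hasDerivAt_id w).sub_const z₁).mul (hQd w).hasDerivAt
    rw [hd.deriv, one_mul]
  refine ⟨by rw [hH']; simp, ?_⟩
  rw [hH']
  have hd : HasDerivAt (fun w ↦ Q w + (w - z₁) * deriv Q w)
      (deriv Q z₁ + (1 * deriv Q z₁ + (z₁ - z₁) * deriv (deriv Q) z₁)) z₁ := by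
    exact (hQd z₁).hasDerivAt.add (((hasDerivAt_id z₁).sub_const z₁).mul (hQ'd z₁).hasDerivAt)
  rw [hd.deriv]
  ring

end IsHadamardSeq

/-- **The Hadamard product of `H_t` over its enumerated zeros** (`t > Λ`): the sequence
`c_j := −1/x_{j+1}(t)²` (`j ∈ ℕ`) is a Hadamard sequence for `H_t`, i.e. `Σ_j 1/x_{j+1}(t)² < ∞` and
`H_t(z) = H_t(0) ∏_{j ≥ 1} (1 − z²/x_j(t)²)` — the genus-`0` product of `exists_isHadamardSeq`
re-indexed by the zeros `0 < x_1(t) < x_2(t) < ⋯` (all zeros being real and simple).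
[cite: RodgersTaoFMP2020, Thm. 11 p. 27] -/
theorem isHadamardSeq_deBruijnZero {t : ℝ}
    (hΛ : ∃ t₁ : ℝ, t₁ < t ∧ HasOnlyRealZeros (deBruijnH t₁)) :
    IsHadamardSeq t (fun j : ℕ ↦ -1 / ((deBruijnZero t (j + 1) : ℝ) : ℂ) ^ 2) := by
  classical
  obtain ⟨b, hb⟩ := exists_isHadamardSeq t
  have hx0 : ∀ j : ℕ, deBruijnH t (deBruijnZero t (j + 1)) = 0 := fun j ↦
    deBruijnH_deBruijnZero hΛ (by omega)
  have hxpos : ∀ j : ℕ, 0 < deBruijnZero t (j + 1) := fun j ↦ deBruijnZero_pos hΛ (by omega)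
  have hxd : ∀ j : ℕ, deriv (deBruijnH t) (deBruijnZero t (j + 1)) ≠ 0 := fun j ↦
    deriv_deBruijnH_deBruijnZero_ne_zero hΛ (by omega)
  have hsingle : ∀ j : ℕ, ∃ n : ℕ, hb.zeroIndices (deBruijnZero t (j + 1) : ℂ) = {n} := fun j ↦
    Finset.card_eq_one.1 (hb.mult_eq_one_of_deriv_ne_zero (hx0 j) (hxd j))
  choose i hi using hsingle
  have hmem : ∀ j, 1 + b (i j) * ((deBruijnZero t (j + 1) : ℝ) : ℂ) ^ 2 = 0 := fun j ↦ by
    have : i j ∈ hb.zeroIndices (deBruijnZero t (j + 1) : ℂ) := by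
      rw [hi j]; exact Finset.mem_singleton_self _
    exact hb.mem_zeroIndices.1 this
  have hbi : ∀ j, b (i j) = -1 / ((deBruijnZero t (j + 1) : ℝ) : ℂ) ^ 2 := fun j ↦ by
    have hx : ((deBruijnZero t (j + 1) : ℝ) : ℂ) ≠ 0 := by exact_mod_cast (hxpos j).ne'
    rw [eq_div_iff (pow_ne_zero 2 hx)]
    linear_combination hmem j
  have hinj : Function.Injective i := by
    intro j j' hjj'
    have h1 := hmem j
    have h2 := hmem j'
    rw [hjj'] at h1
    have hb0 : b (i j') ≠ 0 := by
      intro h0; rw [h0] at h2; norm_num at h2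
    have hsq : ((deBruijnZero t (j + 1) : ℝ) : ℂ) ^ 2 = ((deBruijnZero t (j' + 1) : ℝ) : ℂ) ^ 2 :=
      mul_left_cancel₀ hb0 (by linear_combination h1 - h2)
    have hsq' : deBruijnZero t (j + 1) ^ 2 = deBruijnZero t (j' + 1) ^ 2 := by exact_mod_cast hsq
    have heq : deBruijnZero t (j + 1) = deBruijnZero t (j' + 1) :=
      (pow_left_inj₀ (hxpos j).le (hxpos j').le two_ne_zero).1 hsq'
    have := (strictMono_deBruijnZero hΛ).injective heq
    omega
  have hout : ∀ n, n ∉ Set.range i → b n = 0 := by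
    intro n hn
    by_contra hb0
    set ζ : ℂ := (-(b n)⁻¹) ^ ((2 : ℕ)⁻¹ : ℂ) with hζ
    have hζ2 : ζ ^ 2 = -(b n)⁻¹ := Complex.cpow_nat_inv_pow _ two_ne_zero
    have hfac : 1 + b n * ζ ^ 2 = 0 := by rw [hζ2, mul_neg, mul_inv_cancel₀ hb0]; ring
    have hHζ : deBruijnH t ζ = 0 := hb.eq_zero_of_factor hfac
    obtain ⟨m, hm0, hmζ⟩ := exists_deBruijnZeroZ_eq_of_zero hΛ hHζ
    obtain ⟨p, hp⟩ : ∃ p : ℕ, m.natAbs = p + 1 := ⟨m.natAbs - 1, by omega⟩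
    have hsq : ζ ^ 2 = ((deBruijnZero t (p + 1) : ℝ) : ℂ) ^ 2 := by
      rw [← hmζ, deBruijnZeroZ_eq, hp]
      rcases lt_trichotomy m 0 with h | h | h
      · rw [Int.sign_eq_neg_one_of_neg h]; push_cast; ring
      · exact absurd h hm0
      · rw [Int.sign_eq_one_of_pos h]; push_cast; ring
    have hfac' : 1 + b n * ((deBruijnZero t (p + 1) : ℝ) : ℂ) ^ 2 = 0 := by rw [← hsq]; exact hfac
    have hnmem : n ∈ hb.zeroIndices (deBruijnZero t (p + 1) : ℂ) := hb.mem_zeroIndices.2 hfac'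
    rw [hi p, Finset.mem_singleton] at hnmem
    exact hn ⟨p, hnmem.symm⟩
  refine ⟨?_, fun z ↦ ?_⟩
  · refine (hb.summable.comp_injective hinj).congr fun j ↦ ?_
    simp only [Function.comp_apply, hbi j]
  · have hiff := hinj.hasProd_iff (f := fun n ↦ 1 + b n * z ^ 2)
      (a := deBruijnH t z / deBruijnH t 0) (fun n hn ↦ by simp [hout n hn])
    have h := hiff.2 (hb.hasProd z)
    have e : ((fun n ↦ 1 + b n * z ^ 2) ∘ i) =
        fun j ↦ 1 + -1 / ((deBruijnZero t (j + 1) : ℝ) : ℂ) ^ 2 * z ^ 2 := by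
      funext j; simp only [Function.comp_apply, hbi j]
    rw [e] at h
    exact h

/-- `Σ_{j ≥ 1} 1/x_j(t)² < ∞` for `t > Λ`. [cite: RodgersTaoFMP2020, Thm. 11 p. 27] -/
theorem summable_inv_deBruijnZero_sq {t : ℝ}
    (hΛ : ∃ t₁ : ℝ, t₁ < t ∧ HasOnlyRealZeros (deBruijnH t₁)) :
    Summable fun j : ℕ ↦ 1 / deBruijnZero t (j + 1) ^ 2 := by
  refine (isHadamardSeq_deBruijnZero hΛ).summable.congr fun j ↦ ?_
  rw [norm_div, norm_neg, norm_one, norm_pow, Complex.norm_real, Real.norm_eq_abs, sq_abs]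

/-- The partial-fraction term of the zero-indexed Hadamard product at `z = x_k`:
`2 c_j x_k/(1 + c_j x_k²) = 2 x_k/(x_k² − x_{j+1}²)` for `c_j = −1/x_{j+1}²` (both sides `0` when
`x_{j+1} = ±x_k`). [folklore] -/
private theorem hadamard_term_eq {x y : ℝ} (hy : y ≠ 0) :
    2 * (-1 / ((y : ℂ)) ^ 2) * (x : ℂ) / (1 + -1 / ((y : ℂ)) ^ 2 * (x : ℂ) ^ 2) =
      ((2 * x / (x ^ 2 - y ^ 2) : ℝ) : ℂ) := by
  have hy' : (y : ℂ) ≠ 0 := by exact_mod_cast hy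
  by_cases hxy : x ^ 2 - y ^ 2 = 0
  · have h1 : (1 + -1 / ((y : ℂ)) ^ 2 * (x : ℂ) ^ 2) = 0 := by
      have : (x : ℂ) ^ 2 = (y : ℂ) ^ 2 := by exact_mod_cast (sub_eq_zero.1 hxy)
      rw [this]; field_simp; ring
    rw [h1, hxy, div_zero, div_zero]
    push_cast; rfl
  · have hxy' : (x : ℂ) ^ 2 - (y : ℂ) ^ 2 ≠ 0 := by exact_mod_cast hxy
    have hy2 : (y : ℂ) ^ 2 ≠ 0 := pow_ne_zero 2 hy'
    have e1 : (1 + -1 / ((y : ℂ)) ^ 2 * (x : ℂ) ^ 2) =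
        ((y : ℂ) ^ 2 - (x : ℂ) ^ 2) / (y : ℂ) ^ 2 := by
      field_simp
      ring
    have e2 : 2 * (-1 / ((y : ℂ)) ^ 2) * (x : ℂ) = (-2 * (x : ℂ)) / (y : ℂ) ^ 2 := by
      field_simp
    have hyx : (y : ℂ) ^ 2 - (x : ℂ) ^ 2 ≠ 0 := fun h0 ↦ hxy' (by linear_combination -h0)
    rw [e1, e2, div_div_div_cancel_right₀ hy2, div_eq_iff hyx]
    push_cast
    rw [div_mul_eq_mul_div, eq_div_iff hxy']
    ring

/-! ## Principal value sums and the equations of motion -/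

/-- Symmetric decomposition of a sum over `[−J, J]_{ℤ*}`:
`Σ_{j ∈ [−J,J]_{ℤ*}} g(j) = Σ_{m < J} (g(m+1) + g(−(m+1)))`. [cite: RodgersTaoFMP2020, §1.2 p. 7] -/
theorem sum_zstarIcc_symm (g : ℤ → ℝ) (J : ℕ) :
    ∑ j ∈ zstarIcc (-(J : ℤ)) J, g j =
      ∑ m ∈ Finset.range J, (g ((m : ℤ) + 1) + g (-((m : ℤ) + 1))) := by
  induction J with
  | zero =>
    rw [Finset.sum_range_zero]
    have : zstarIcc (-((0 : ℕ) : ℤ)) ((0 : ℕ) : ℤ) = ∅ := by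
      ext j; simp only [mem_zstarIcc, Finset.notMem_empty, iff_false]; push_cast; omega
    rw [this, Finset.sum_empty]
  | succ J ih =>
    have hset : zstarIcc (-((J + 1 : ℕ) : ℤ)) ((J + 1 : ℕ) : ℤ) =
        insert ((J : ℤ) + 1) (insert (-((J : ℤ) + 1)) (zstarIcc (-(J : ℤ)) J)) := by
      ext j; simp only [mem_zstarIcc, Finset.mem_insert]; push_cast; omega
    rw [hset, Finset.sum_insert, Finset.sum_insert, ih, Finset.sum_range_succ]
    · ring
    · simp only [mem_zstarIcc]; omega
    · simp only [Finset.mem_insert, mem_zstarIcc]; omega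

/-- Pairing the terms `j = ±m`: `1/(x − y) + 1/(x − (−y)) = 2x/(x² − y²)` when `x ≠ ±y`.
[folklore] -/
private theorem inv_sub_add_inv_add {x y : ℝ} (h1 : x - y ≠ 0) (h2 : x + y ≠ 0) :
    1 / (x - y) + 1 / (x - -y) = 2 * x / (x ^ 2 - y ^ 2) := by
  have h3 : x ^ 2 - y ^ 2 ≠ 0 := by
    have : x ^ 2 - y ^ 2 = (x - y) * (x + y) := by ring
    rw [this]; exact mul_ne_zero h1 h2
  rw [sub_neg_eq_add]
  field_simp
  ring

/-- **The principal value partial sums in closed form.** For `t > Λ`, `k ∈ ℤ*` and `J ≥ |k|`: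
`Σ_{j ∈ [−J,J]_{ℤ*}, j ≠ k} 1/(x_k − x_j) = 1/(2x_k) + Σ_{m=1}^{J} 2x_k/(x_k² − x_m²)`, where the
term
`m = |k|` reads `0` (`x_{−j} = −x_j` pairs `j = ±m`; the term `j = −k` is `1/(2x_k)`).
[cite: RodgersTaoFMP2020, Thm. 11 p. 27 (56)] -/
theorem zeroVelocityPartialSum_eq_sum {t : ℝ}
    (hΛ : ∃ t₁ : ℝ, t₁ < t ∧ HasOnlyRealZeros (deBruijnH t₁)) {k : ℤ} (hk : k ≠ 0) {J : ℕ}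
    (hJ : k.natAbs ≤ J) :
    zeroVelocityPartialSum t k J = 1 / (2 * deBruijnZeroZ t k) +
      ∑ m ∈ Finset.range J,
        2 * deBruijnZeroZ t k / (deBruijnZeroZ t k ^ 2 - deBruijnZero t (m + 1) ^ 2) := by
  have hself : (1 : ℝ) / (deBruijnZeroZ t k - deBruijnZeroZ t k) = 0 := by simp
  rw [zeroVelocityPartialSum_eq,
    Finset.sum_erase (f := fun j ↦ 1 / (deBruijnZeroZ t k - deBruijnZeroZ t j)) _ hself,
    sum_zstarIcc_symm (fun j ↦ 1 / (deBruijnZeroZ t k - deBruijnZeroZ t j))]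
  -- rewrite the paired terms
  have hpair : ∀ m ∈ Finset.range J,
      1 / (deBruijnZeroZ t k - deBruijnZeroZ t ((m : ℤ) + 1)) +
          1 / (deBruijnZeroZ t k - deBruijnZeroZ t (-((m : ℤ) + 1))) =
        2 * deBruijnZeroZ t k / (deBruijnZeroZ t k ^ 2 - deBruijnZero t (m + 1) ^ 2) +
          (if m = k.natAbs - 1 then 1 / (2 * deBruijnZeroZ t k) else 0) := by
    intro m _
    have hcast : (m : ℤ) + 1 = ((m + 1 : ℕ) : ℤ) := by push_cast; ring
    rw [hcast, deBruijnZeroZ_neg, deBruijnZeroZ_natCast]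
    by_cases hm : m = k.natAbs - 1
    · rw [if_pos hm]
      have hmk : m + 1 = k.natAbs := by omega
      rw [hmk]
      rcases lt_or_gt_of_ne hk with hneg | hpos
      · -- `k < 0`: `x_k = −x_{|k|}`
        have hk' : -((k.natAbs : ℕ) : ℤ) = k := by omega
        have hx : deBruijnZeroZ t k = -deBruijnZero t k.natAbs := by
          rw [← deBruijnZeroZ_neg_natCast, hk']
        rw [hx]
        have e1 : -deBruijnZero t k.natAbs - deBruijnZero t k.natAbs =
            2 * -deBruijnZero t k.natAbs := by ring
        rw [e1, sub_neg_eq_add, neg_add_cancel, div_zero, add_zero, neg_sq, sub_self, div_zero,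
          zero_add]
      · -- `k > 0`: `x_k = x_{|k|}`
        have hk' : ((k.natAbs : ℕ) : ℤ) = k := by omega
        have hx : deBruijnZeroZ t k = deBruijnZero t k.natAbs := by
          rw [← deBruijnZeroZ_natCast, hk']
        rw [hx, sub_self, div_zero, zero_add, sub_neg_eq_add, sub_self, div_zero, zero_add]
        ring
    · rw [if_neg hm, add_zero]
      have hne1 : k ≠ ((m + 1 : ℕ) : ℤ) := by omega
      have hne2 : k ≠ -((m + 1 : ℕ) : ℤ) := by omega
      have h1 : deBruijnZeroZ t k - deBruijnZero t (m + 1) ≠ 0 := by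
        rw [← deBruijnZeroZ_natCast]; exact deBruijnZeroZ_sub_ne_zero hΛ hne1.symm
      have h2 : deBruijnZeroZ t k + deBruijnZero t (m + 1) ≠ 0 := by
        rw [← deBruijnZeroZ_natCast, ← sub_neg_eq_add, ← deBruijnZeroZ_neg]
        exact deBruijnZeroZ_sub_ne_zero hΛ hne2.symm
      exact inv_sub_add_inv_add h1 h2
  rw [Finset.sum_congr rfl hpair, Finset.sum_add_distrib, Finset.sum_ite_eq']
  have hmem : k.natAbs - 1 ∈ Finset.range J := by rw [Finset.mem_range]; omega
  rw [if_pos hmem, add_comm]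

/-- The velocity series of `x_k` (`t > Λ`, `k ∈ ℤ*`): `m ↦ 2x_k/(x_k² − x_{m+1}²)` is summable (it
is the partial-fraction series of `H_t'/H_t` in the zero-indexed Hadamard product).
[cite: RodgersTaoFMP2020, Thm. 11 p. 27 (56)] -/
theorem summable_velocity_terms {t : ℝ}
    (hΛ : ∃ t₁ : ℝ, t₁ < t ∧ HasOnlyRealZeros (deBruijnH t₁)) (k : ℤ) :
    Summable fun m : ℕ ↦
      2 * deBruijnZeroZ t k / (deBruijnZeroZ t k ^ 2 - deBruijnZero t (m + 1) ^ 2) := by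
  have hc := isHadamardSeq_deBruijnZero hΛ
  have hs := summable_logDeriv_terms hc.summable (deBruijnZeroZ t k : ℂ)
  rw [← Complex.summable_ofReal]
  refine hs.congr fun m ↦ ?_
  exact hadamard_term_eq (deBruijnZero_pos hΛ (by omega)).ne'

/-- **Convergence of the principal value sum** `Σ'_{j ≠ k} 1/(x_k − x_j)` for `t > Λ`, `k ∈ ℤ*`,
to `1/(2x_k) + Σ_{m ≥ 1} 2x_k/(x_k² − x_m²)`. [cite: RodgersTaoFMP2020, Thm. 11 p. 27 (56)] -/
theorem tendsto_zeroVelocityPartialSum {t : ℝ}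
    (hΛ : ∃ t₁ : ℝ, t₁ < t ∧ HasOnlyRealZeros (deBruijnH t₁)) {k : ℤ} (hk : k ≠ 0) :
    Tendsto (zeroVelocityPartialSum t k) atTop
      (𝓝 (1 / (2 * deBruijnZeroZ t k) +
        ∑' m : ℕ,
          2 * deBruijnZeroZ t k / (deBruijnZeroZ t k ^ 2 - deBruijnZero t (m + 1) ^ 2))) := by
  have hs := summable_velocity_terms hΛ k
  have h1 := hs.hasSum.tendsto_sum_nat
  have h2 := (tendsto_const_nhds (x := 1 / (2 * deBruijnZeroZ t k))).add h1
  refine h2.congr' ?_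
  rw [Filter.EventuallyEq, Filter.eventually_atTop]
  exact ⟨k.natAbs, fun J hJ ↦ (zeroVelocityPartialSum_eq_sum hΛ hk hJ).symm⟩

/-- **The equation of motion at one time**: for `t > Λ`, `k ∈ ℤ*`, the implicit-function velocity
`−Re ∂ₜH_t(x_k)/Re H_t'(x_k) = H_t''(x_k)/H_t'(x_k)` equals
`2 (1/(2x_k) + Σ_{m ≥ 1} 2x_k/(x_k² − x_m²))`
(`H_t'' (x_k)/H_t'(x_k) = 2 Q'(x_k)/Q(x_k)` for the cofactor `Q`, and `Q'/Q` is the partial-fraction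
series of the zero-indexed Hadamard product). [cite: RodgersTaoFMP2020, Thm. 11 p. 27 (56)] -/
theorem velocity_eq_two_mul_series {t : ℝ}
    (hΛ : ∃ t₁ : ℝ, t₁ < t ∧ HasOnlyRealZeros (deBruijnH t₁)) {k : ℤ} (hk : k ≠ 0) :
    -(cosMoment 2 t (deBruijnZeroZ t k)).re / (deriv (deBruijnH t) (deBruijnZeroZ t k)).re =
      2 * (1 / (2 * deBruijnZeroZ t k) +
        ∑' m : ℕ,
          2 * deBruijnZeroZ t k / (deBruijnZeroZ t k ^ 2 - deBruijnZero t (m + 1) ^ 2)) := by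
  have hc := isHadamardSeq_deBruijnZero hΛ
  set xk := deBruijnZeroZ t k with hxk
  set z₁ : ℂ := (xk : ℂ) with hz₁def
  set v : ℝ := 1 / (2 * xk) + ∑' m : ℕ, 2 * xk / (xk ^ 2 - deBruijnZero t (m + 1) ^ 2) with hv
  have hz₁ : deBruijnH t z₁ = 0 := deBruijnH_deBruijnZeroZ hΛ hk
  have hd : deriv (deBruijnH t) z₁ ≠ 0 := deriv_deBruijnH_deBruijnZeroZ_ne_zero hΛ hk
  have hm : hc.mult z₁ = 1 := hc.mult_eq_one_of_deriv_ne_zero hz₁ hd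
  obtain ⟨hQ1, hQ2⟩ := hc.deriv_eq_cofactor_of_mult_eq_one hz₁ hm
  have hxk0 : xk ≠ 0 := deBruijnZeroZ_ne_zero hΛ hk
  -- the regularised logarithmic derivative is `v`
  have hlog : logDeriv (hc.cofactor z₁) z₁ = (v : ℂ) := by
    rw [hc.logDeriv_cofactor_self hz₁, hm, hv]
    have hterms : ∀ m : ℕ, 2 * (-1 / ((deBruijnZero t (m + 1) : ℝ) : ℂ) ^ 2) * z₁ /
        (1 + -1 / ((deBruijnZero t (m + 1) : ℝ) : ℂ) ^ 2 * z₁ ^ 2) =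
        ((2 * xk / (xk ^ 2 - deBruijnZero t (m + 1) ^ 2) : ℝ) : ℂ) := fun m ↦
      hadamard_term_eq (deBruijnZero_pos hΛ (by omega)).ne'
    rw [tsum_congr hterms, ← Complex.ofReal_tsum]
    push_cast
    ring
  have hQne : hc.cofactor z₁ z₁ ≠ 0 := hc.cofactor_self_ne_zero hz₁
  have hQ' : deriv (hc.cofactor z₁) z₁ = (v : ℂ) * hc.cofactor z₁ z₁ := by
    rw [logDeriv_apply, div_eq_iff hQne] at hlog
    exact hlog
  -- `H'' (x_k) = 2 v H'(x_k)`
  have hH2 : deriv (deriv (deBruijnH t)) z₁ = 2 * (v : ℂ) * deriv (deBruijnH t) z₁ := by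
    rw [hQ2, hQ', hQ1]; ring
  have hcos : -cosMoment 2 t z₁ = deriv (deriv (deBruijnH t)) z₁ := by
    rw [deriv_deriv_deBruijnH]
  have hre : -(cosMoment 2 t z₁).re = 2 * v * (deriv (deBruijnH t) z₁).re := by
    have := congrArg Complex.re hcos
    rw [Complex.neg_re] at this
    rw [this, hH2]
    have e : (2 : ℂ) * (v : ℂ) = ((2 * v : ℝ) : ℂ) := by push_cast; ring
    rw [e, Complex.re_ofReal_mul]
  have hdre : (deriv (deBruijnH t) z₁).re ≠ 0 := re_deriv_deBruijnH_deBruijnZeroZ_ne_zero hΛ hk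
  rw [hre, mul_div_assoc, div_self hdre, mul_one]

/-- **The equations of motion (56)** for `t > Λ`, `k ∈ ℤ*`: the principal value sum converges (to
`zeroVelocitySum t k`) and `∂ₜ x_k(t) = 2 Σ'_{j ≠ k} 1/(x_k(t) − x_j(t))`.
[cite: RodgersTaoFMP2020, Thm. 11 p. 27 (56)] -/
theorem hasDerivAt_deBruijnZeroZ_velocitySum {t : ℝ}
    (hΛ : ∃ t₁ : ℝ, t₁ < t ∧ HasOnlyRealZeros (deBruijnH t₁)) {k : ℤ} (hk : k ≠ 0) :
    Tendsto (zeroVelocityPartialSum t k) atTop (𝓝 (zeroVelocitySum t k)) ∧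
      HasDerivAt (fun s ↦ deBruijnZeroZ s k) (2 * zeroVelocitySum t k) t := by
  have h1 := tendsto_zeroVelocityPartialSum hΛ hk
  have hv := zeroVelocitySum_eq_of_tendsto h1
  refine ⟨by rw [hv]; exact h1, ?_⟩
  rw [hv, ← velocity_eq_two_mul_series hΛ hk]
  exact hasDerivAt_deBruijnZeroZ hΛ hk

/-- The velocity `s ↦ −Re ∂ₛH_s(x_k(s))/Re H_s'(x_k(s))` is continuous at every `t > Λ` (joint
continuity of `∂ₛH_s`, `H_s'` and continuity of `x_k`). [cite: RodgersTaoFMP2020, Thm. 11 p. 27] -/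
theorem continuousAt_velocity {t : ℝ}
    (hΛ : ∃ t₁ : ℝ, t₁ < t ∧ HasOnlyRealZeros (deBruijnH t₁)) {k : ℤ} (hk : k ≠ 0) :
    ContinuousAt (fun s ↦ -(cosMoment 2 s (deBruijnZeroZ s k)).re /
      (deriv (deBruijnH s) (deBruijnZeroZ s k)).re) t := by
  have hg : ContinuousAt (fun s ↦ (s, deBruijnZeroZ s k)) t :=
    continuousAt_id.prodMk (continuousAt_deBruijnZeroZ hΛ k)
  have h1 : ContinuousAt (fun s ↦ (cosMoment 2 s (deBruijnZeroZ s k)).re) t :=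
    ContinuousAt.comp_of_eq (f := fun s ↦ (s, deBruijnZeroZ s k))
      continuous_re_cosMoment_two_uncurry.continuousAt hg rfl
  have h2 : ContinuousAt (fun s ↦ (deriv (deBruijnH s) (deBruijnZeroZ s k)).re) t :=
    ContinuousAt.comp_of_eq (f := fun s ↦ (s, deBruijnZeroZ s k))
      continuous_re_deriv_deBruijnH_uncurry.continuousAt hg rfl
  exact h1.neg.div h2 (re_deriv_deBruijnH_deBruijnZeroZ_ne_zero hΛ hk)

/-- **`C¹` dependence of the zeros on `t`** (Thm. 11, first clause): `s ↦ x_k(s)` is continuously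
differentiable at every `t > Λ`, `k ∈ ℤ*`. [cite: RodgersTaoFMP2020, Thm. 11 p. 27] -/
theorem contDiffAt_deBruijnZeroZ {t : ℝ}
    (hΛ : ∃ t₁ : ℝ, t₁ < t ∧ HasOnlyRealZeros (deBruijnH t₁)) {k : ℤ} (hk : k ≠ 0) :
    ContDiffAt ℝ 1 (fun s ↦ deBruijnZeroZ s k) t := by
  obtain ⟨t₁, ht₁, hreal⟩ := hΛ
  set D : ℝ → ℝ := fun s ↦ -(cosMoment 2 s (deBruijnZeroZ s k)).re /
      (deriv (deBruijnH s) (deBruijnZeroZ s k)).re with hD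
  have hderiv : ∀ s ∈ Ioi t₁, HasDerivAt (fun s ↦ deBruijnZeroZ s k) (D s) s := fun s hs ↦
    hasDerivAt_deBruijnZeroZ ⟨t₁, hs, hreal⟩ hk
  have hdiff : DifferentiableOn ℝ (fun s ↦ deBruijnZeroZ s k) (Ioi t₁) := fun s hs ↦
    (hderiv s hs).differentiableAt.differentiableWithinAt
  have hDc : ContinuousOn D (Ioi t₁) := fun s hs ↦
    (continuousAt_velocity ⟨t₁, hs, hreal⟩ hk).continuousWithinAt
  have hderiv' : ∀ s ∈ Ioi t₁, deriv (fun s ↦ deBruijnZeroZ s k) s = D s := fun s hs ↦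
    (hderiv s hs).deriv
  have h1 : ContDiffOn ℝ 1 (fun s ↦ deBruijnZeroZ s k) (Ioi t₁) := by
    rw [contDiffOn_one_iff_derivWithin isOpen_Ioi.uniqueDiffOn]
    refine ⟨hdiff, hDc.congr fun s hs ↦ ?_⟩
    rw [derivWithin_of_isOpen isOpen_Ioi hs, hderiv' s hs]
  exact h1.contDiffAt (Ioi_mem_nhds ht₁)

/-- **Rodgers–Tao 2020, Theorem 11 (= Thm. 4.1), discharged**: for every `t > Λ` and `k ∈ ℤ*`,
`s ↦ x_k(s)` is `C¹` at `t`, the principal value sum `Σ'_{j ≠ k} 1/(x_k − x_j)` converges, and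
`∂ₜ x_k(t) = 2 Σ'_{j ≠ k} 1/(x_k(t) − x_j(t))`. CONTENT discharge (implicit differentiation from the
backwards heat equation and the joint continuity of `H`, `∂ₜH`, `H'`; the identity
`H_t''(x_k)/H_t'(x_k) = 2 Σ'_{j ≠ k} 1/(x_k − x_j)` from the genus-`0` Hadamard product re-indexed
over the real simple zeros) — no `Λ < 0` antecedent, not ex falso.
[cite: RodgersTaoFMP2020, Thm. 11 p. 27 (56)] -/
theorem rodgers_tao_zero_dynamics_holds : rodgers_tao_zero_dynamics := by
  intro t hΛ k hk
  exact ⟨contDiffAt_deBruijnZeroZ hΛ hk, hasDerivAt_deBruijnZeroZ_velocitySum hΛ hk⟩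


/-! ## Lemma 12 (i): dynamics of a gap -/

/-- The positive zeros escape to infinity: `x_n(t) → ∞` (`t > Λ`; from `Σ 1/x_n² < ∞`).
[cite: RodgersTaoFMP2020, §1.2 p. 7] -/
theorem tendsto_deBruijnZero_atTop {t : ℝ}
    (hΛ : ∃ t₁ : ℝ, t₁ < t ∧ HasOnlyRealZeros (deBruijnH t₁)) :
    Tendsto (fun n : ℕ ↦ deBruijnZero t n) atTop atTop := by
  have hs := (summable_inv_deBruijnZero_sq hΛ).tendsto_atTop_zero
  rw [← tendsto_add_atTop_iff_nat 1]
  refine tendsto_atTop.2 fun M ↦ ?_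
  rcases le_or_gt M 0 with hM | hM
  · exact Eventually.of_forall fun n ↦ hM.trans (deBruijnZero_nonneg t (n + 1))
  · have hev := hs.eventually (gt_mem_nhds (show (0 : ℝ) < 1 / M ^ 2 by positivity))
    filter_upwards [hev] with n hn
    have hx : 0 < deBruijnZero t (n + 1) := deBruijnZero_pos hΛ (by omega)
    have h1 : M ^ 2 < deBruijnZero t (n + 1) ^ 2 := by
      rwa [one_div_lt_one_div (pow_pos hx 2) (pow_pos hM 2)] at hn
    exact (lt_of_pow_lt_pow_left₀ 2 hx.le h1).le

/-- Far zeros couple weakly: if `|a|, |b| ≤ M` and `2M ≤ |x|`, `x ≠ 0`, then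
`|1/((x − a)(x − b))| ≤ 4/x²`. [folklore] -/
private theorem abs_crossTerm_le {x a b M : ℝ} (ha : |a| ≤ M) (hb : |b| ≤ M) (hx : 2 * M ≤ |x|)
    (hx0 : x ≠ 0) : |1 / ((x - a) * (x - b))| ≤ 4 / x ^ 2 := by
  have hxpos : 0 < |x| := abs_pos.2 hx0
  have h1 : |x| / 2 ≤ |x - a| := by
    have := abs_sub_abs_le_abs_sub x a
    linarith
  have h2 : |x| / 2 ≤ |x - b| := by
    have := abs_sub_abs_le_abs_sub x b
    linarith
  have hprod : x ^ 2 / 4 ≤ |(x - a) * (x - b)| := by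
    rw [abs_mul]
    have e : x ^ 2 / 4 = (|x| / 2) * (|x| / 2) := by rw [← sq_abs]; ring
    rw [e]
    exact mul_le_mul h1 h2 (by positivity) (abs_nonneg _)
  rw [abs_div, abs_one]
  calc 1 / |(x - a) * (x - b)| ≤ 1 / (x ^ 2 / 4) :=
        one_div_le_one_div_of_le (by positivity) hprod
    _ = 4 / x ^ 2 := by field_simp

/-- **Absolute convergence of the gap-dynamics series**: for `t > Λ` and any `k, j`, the cross terms
`i ↦ 1/((x_i − x_k)(x_i − x_j))` are summable over `i ∈ ℤ` (comparison with `4/x_i²`, "thanks to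
(50), (43)" in the source; here from `Σ 1/x_i² < ∞`, the Hadamard product).
[cite: RodgersTaoFMP2020, Lemma 12 (i) p. 30] -/
theorem summable_rodgersTaoCrossTerm_int {t : ℝ}
    (hΛ : ∃ t₁ : ℝ, t₁ < t ∧ HasOnlyRealZeros (deBruijnH t₁)) (k j : ℤ) :
    Summable fun i : ℤ ↦ rodgersTaoCrossTerm t k j i := by
  set M : ℝ := max |deBruijnZeroZ t k| |deBruijnZeroZ t j| with hM
  have hMk : |deBruijnZeroZ t k| ≤ M := le_max_left _ _
  have hMj : |deBruijnZeroZ t j| ≤ M := le_max_right _ _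
  -- the comparison sequence `4/x_n²` on `ℕ`
  have hg : Summable fun n : ℕ ↦ 4 / deBruijnZero t n ^ 2 := by
    have h1 : Summable fun n : ℕ ↦ 1 / deBruijnZero t n ^ 2 :=
      (summable_nat_add_iff 1).1 (summable_inv_deBruijnZero_sq hΛ)
    refine (h1.mul_left 4).congr fun n ↦ ?_
    ring
  have hev : ∀ᶠ n : ℕ in atTop, 2 * M ≤ deBruijnZero t n ∧ 0 < deBruijnZero t n := by
    filter_upwards [(tendsto_deBruijnZero_atTop hΛ).eventually (eventually_ge_atTop (2 * M)),
      (tendsto_deBruijnZero_atTop hΛ).eventually (eventually_gt_atTop 0)] with n h1 h2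
    exact ⟨h1, h2⟩
  rw [summable_int_iff_summable_nat_and_neg]
  constructor
  · refine Summable.of_norm_bounded_eventually hg ?_
    rw [Nat.cofinite_eq_atTop]
    filter_upwards [hev] with n ⟨hn, hn0⟩
    rw [Real.norm_eq_abs, rodgersTaoCrossTerm_eq, deBruijnZeroZ_natCast]
    exact abs_crossTerm_le hMk hMj (by rwa [abs_of_pos hn0]) hn0.ne'
  · refine Summable.of_norm_bounded_eventually hg ?_
    rw [Nat.cofinite_eq_atTop]
    filter_upwards [hev] with n ⟨hn, hn0⟩
    rw [Real.norm_eq_abs, rodgersTaoCrossTerm_eq, deBruijnZeroZ_neg_natCast]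
    have h := abs_crossTerm_le hMk hMj (x := -deBruijnZero t n)
      (by rwa [abs_neg, abs_of_pos hn0]) (neg_ne_zero.2 hn0.ne')
    rwa [neg_sq] at h

/-- **The truncated gap identity** (source, proof of Lemma 12 (i), p. 31): for `J ≥ |k|, |j|`,
`Σ_{i ∈ [−J,J]_{ℤ*}, i ≠ k} 1/(x_k − x_i) − Σ_{i ∈ [−J,J]_{ℤ*}, i ≠ j} 1/(x_j − x_i)
 = 2/(x_k − x_j) − (x_k − x_j) Σ_{i ∈ [−J,J]_{ℤ*} ∖ {k,j}} 1/((x_i − x_k)(x_i − x_j))`.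
[cite: RodgersTaoFMP2020, Lemma 12 (i) p. 31] -/
theorem zeroVelocityPartialSum_sub {t : ℝ}
    (hΛ : ∃ t₁ : ℝ, t₁ < t ∧ HasOnlyRealZeros (deBruijnH t₁)) {k j : ℤ} (hk : k ≠ 0) (hj : j ≠ 0)
    (hjk : j ≠ k) {J : ℕ} (hJk : k.natAbs ≤ J) (hJj : j.natAbs ≤ J) :
    zeroVelocityPartialSum t k J - zeroVelocityPartialSum t j J =
      2 / (deBruijnZeroZ t k - deBruijnZeroZ t j) - (deBruijnZeroZ t k - deBruijnZeroZ t j) *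
        ∑ i ∈ ((zstarIcc (-(J : ℤ)) J).erase k).erase j, rodgersTaoCrossTerm t k j i := by
  set W := zstarIcc (-(J : ℤ)) J with hW
  have hkW : k ∈ W := by rw [hW, mem_zstarIcc]; omega
  have hjW : j ∈ W := by rw [hW, mem_zstarIcc]; omega
  have hjWk : j ∈ W.erase k := Finset.mem_erase.2 ⟨hjk, hjW⟩
  have hkWj : k ∈ W.erase j := Finset.mem_erase.2 ⟨hjk.symm, hkW⟩
  rw [zeroVelocityPartialSum_eq, zeroVelocityPartialSum_eq, ← hW,
    ← Finset.add_sum_erase _ _ hjWk, ← Finset.add_sum_erase _ _ hkWj,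
    Finset.erase_right_comm (a := j)]
  set T := (W.erase k).erase j with hT
  have hxkj : deBruijnZeroZ t k - deBruijnZeroZ t j ≠ 0 := deBruijnZeroZ_sub_ne_zero hΛ hjk
  have hterm : ∀ i ∈ T, 1 / (deBruijnZeroZ t k - deBruijnZeroZ t i) -
      1 / (deBruijnZeroZ t j - deBruijnZeroZ t i) =
      -((deBruijnZeroZ t k - deBruijnZeroZ t j) * rodgersTaoCrossTerm t k j i) := by
    intro i hi
    have hik : i ≠ k := Finset.ne_of_mem_erase (Finset.mem_of_mem_erase hi)
    have hij : i ≠ j := Finset.ne_of_mem_erase hi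
    have h1 : deBruijnZeroZ t k - deBruijnZeroZ t i ≠ 0 := deBruijnZeroZ_sub_ne_zero hΛ hik
    have h2 : deBruijnZeroZ t j - deBruijnZeroZ t i ≠ 0 := deBruijnZeroZ_sub_ne_zero hΛ hij
    have h3 : deBruijnZeroZ t i - deBruijnZeroZ t k ≠ 0 := deBruijnZeroZ_sub_ne_zero hΛ hik.symm
    have h4 : deBruijnZeroZ t i - deBruijnZeroZ t j ≠ 0 := deBruijnZeroZ_sub_ne_zero hΛ hij.symm
    rw [rodgersTaoCrossTerm_eq]
    field_simp
    ring
  have hsum : ∑ i ∈ T, 1 / (deBruijnZeroZ t k - deBruijnZeroZ t i) -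
      ∑ i ∈ T, 1 / (deBruijnZeroZ t j - deBruijnZeroZ t i) =
      -((deBruijnZeroZ t k - deBruijnZeroZ t j) * ∑ i ∈ T, rodgersTaoCrossTerm t k j i) := by
    rw [← Finset.sum_sub_distrib, Finset.sum_congr rfl hterm, Finset.sum_neg_distrib,
      Finset.mul_sum]
  have hfirst : 1 / (deBruijnZeroZ t k - deBruijnZeroZ t j) -
      1 / (deBruijnZeroZ t j - deBruijnZeroZ t k) =
      2 / (deBruijnZeroZ t k - deBruijnZeroZ t j) := by
    rw [show deBruijnZeroZ t j - deBruijnZeroZ t k =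
        -(deBruijnZeroZ t k - deBruijnZeroZ t j) by ring, one_div_neg_eq_neg_one_div]
    ring
  linear_combination hfirst + hsum

/-- **The truncations converge**: `Σ_{i ∈ [−J,J]_{ℤ*} ∖ {k,j}} 1/((x_i − x_k)(x_i − x_j)) →
Σ_{i ∈ ℤ* ∖ {k,j}} 1/((x_i − x_k)(x_i − x_j))` as `J → ∞` (`t > Λ`).
[cite: RodgersTaoFMP2020, Lemma 12 (i) p. 31] -/
theorem tendsto_sum_rodgersTaoCrossTerm {t : ℝ}
    (hΛ : ∃ t₁ : ℝ, t₁ < t ∧ HasOnlyRealZeros (deBruijnH t₁)) (k j : ℤ) :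
    Tendsto (fun J : ℕ ↦ ∑ i ∈ ((zstarIcc (-(J : ℤ)) J).erase k).erase j,
      rodgersTaoCrossTerm t k j i) atTop (𝓝 (rodgersTaoCrossSum t {k, j} k j)) := by
  classical
  set C : Set ℤ := zstarCompl ({k, j} : Finset ℤ) with hC
  have hsub : Summable (fun i : C ↦ rodgersTaoCrossTerm t k j i) :=
    (summable_rodgersTaoCrossTerm_int hΛ k j).subtype _
  have hhas : HasSum (C.indicator fun i ↦ rodgersTaoCrossTerm t k j i)
      (rodgersTaoCrossSum t {k, j} k j) := by
    rw [rodgersTaoCrossSum_eq, ← hC]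
    exact hasSum_subtype_iff_indicator.1 hsub.hasSum
  -- partial sums over the windows `[−J, J]`
  have hwin : Tendsto (fun J : ℕ ↦ Finset.Icc (-(J : ℤ)) J) atTop atTop := by
    refine tendsto_atTop_finset_of_monotone (fun J J' h ↦ Finset.Icc_subset_Icc ?_ ?_) fun i ↦
      ⟨i.natAbs, Finset.mem_Icc.2 ⟨by omega, by omega⟩⟩
    · exact neg_le_neg (by exact_mod_cast h)
    · exact_mod_cast h
  have h := hhas.comp hwin
  refine h.congr fun J ↦ ?_
  simp only [Function.comp_apply]
  rw [← Finset.sum_filter_add_sum_filter_not (Finset.Icc (-(J : ℤ)) J) (· ∈ C)]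
  have hzero : ∑ i ∈ (Finset.Icc (-(J : ℤ)) J).filter (· ∉ C),
      C.indicator (fun i ↦ rodgersTaoCrossTerm t k j i) i = 0 :=
    Finset.sum_eq_zero fun i hi ↦ Set.indicator_of_notMem (Finset.mem_filter.1 hi).2 _
  rw [hzero, add_zero]
  have hset : (Finset.Icc (-(J : ℤ)) J).filter (· ∈ C) =
      ((zstarIcc (-(J : ℤ)) J).erase k).erase j := by
    ext i
    simp only [Finset.mem_filter, Finset.mem_Icc, hC, mem_zstarCompl, Finset.mem_insert,
      Finset.mem_singleton, Finset.mem_erase, mem_zstarIcc]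
    tauto
  rw [hset]
  exact Finset.sum_congr rfl fun i hi ↦ Set.indicator_of_mem (by
    have := hi
    rw [← hset, Finset.mem_filter] at this
    exact this.2) _

/-- **Rodgers–Tao 2020, Lemma 12 (i) (= Lemma 4.2 (i)), discharged**: for `t > Λ` and distinct
`j, k ∈ ℤ*`, the series `Σ_{i ≠ k,j} 1/((x_i − x_k)(x_i − x_j))` converges absolutely and
`∂ₜ(x_k − x_j) = 4/(x_k − x_j) − 2(x_k − x_j) Σ_{i ≠ k,j} 1/((x_i − x_k)(x_i − x_j))`. CONTENT
discharge, following the printed proof (p. 31): subtract the equations of motion (56) for `x_k` and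
`x_j` (`rodgers_tao_zero_dynamics_holds`), rearrange the truncated principal value sums
(`zeroVelocityPartialSum_sub`) and pass to the limit (`tendsto_sum_rodgersTaoCrossTerm`).
[cite: RodgersTaoFMP2020, Lemma 12 (i) p. 30] -/
theorem rodgers_tao_gap_dynamics_holds : rodgers_tao_gap_dynamics := by
  intro t hΛ j k hj hk hjk
  refine ⟨(summable_rodgersTaoCrossTerm_int hΛ k j).subtype _, ?_⟩
  obtain ⟨hTk, hDk⟩ := hasDerivAt_deBruijnZeroZ_velocitySum hΛ hk
  obtain ⟨hTj, hDj⟩ := hasDerivAt_deBruijnZeroZ_velocitySum hΛ hj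
  have hD := hDk.sub hDj
  have hlim1 : Tendsto (fun J ↦ zeroVelocityPartialSum t k J - zeroVelocityPartialSum t j J) atTop
      (𝓝 (zeroVelocitySum t k - zeroVelocitySum t j)) := hTk.sub hTj
  have hlim2 : Tendsto (fun J ↦ zeroVelocityPartialSum t k J - zeroVelocityPartialSum t j J) atTop
      (𝓝 (2 / (deBruijnZeroZ t k - deBruijnZeroZ t j) - (deBruijnZeroZ t k - deBruijnZeroZ t j) *
        rodgersTaoCrossSum t {k, j} k j)) := by
    have h2 := (tendsto_const_nhds (x := 2 / (deBruijnZeroZ t k - deBruijnZeroZ t j))).sub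
      ((tendsto_sum_rodgersTaoCrossTerm hΛ k j).const_mul (deBruijnZeroZ t k - deBruijnZeroZ t j))
    refine h2.congr' ?_
    filter_upwards [eventually_ge_atTop (max k.natAbs j.natAbs)] with J hJ
    exact (zeroVelocityPartialSum_sub hΛ hk hj hjk (le_of_max_le_left hJ)
      (le_of_max_le_right hJ)).symm
  have heq := tendsto_nhds_unique hlim1 hlim2
  have hval : 2 * zeroVelocitySum t k - 2 * zeroVelocitySum t j =
      4 / (deBruijnZeroZ t k - deBruijnZeroZ t j) -
        2 * (deBruijnZeroZ t k - deBruijnZeroZ t j) * rodgersTaoCrossSum t {k, j} k j := by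
    linear_combination 2 * heq
  rw [hval] at hD
  exact hD

/-! ## Lemma 12 (v) and (iv): the Hamiltonian and virial identities

Appended (second filing): the named facts `rodgers_tao_hamiltonian_identity` (Lemma 12 (v)) and
`rodgers_tao_virial_identity` (Lemma 12 (iv)) of `RodgersTaoZeroDynamics.lean` are discharged as
`rodgers_tao_hamiltonian_identity_holds` and `rodgers_tao_virial_identity_holds` — CONTENT
discharges following the printed proof (FMP p. 33): differentiate each term with (i), split the
environment `ℤ* ∖ {k,k'} = (K ∖ {k,k'}) ⊔ (ℤ* ∖ K)` (`rodgersTaoCrossSum_pair_eq`), and dispose of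
the triple sums over `K` by cyclic symmetrisation over the cube `K³` (the degenerate triples
contribute `0` thanks to `1/0 = 0`): "the summand antisymmetrizes to zero" for (v)
(`sum_offDiag_sum_rodgersTaoCrossTerm_eq_zero`), and
`Σ_{distinct} (x_k − x_{k'})²/((x_{k''} − x_k)(x_{k''} − x_{k'})) = −|K|(|K| − 1)(|K| − 2)` for (iv)
(`sum_offDiag_sq_mul_sum_rodgersTaoCrossTerm`; each cyclic orbit contributes `−3` since
`u³ + v³ + w³ = 3uvw` when `u + v + w = 0`). -/

/-- Splitting the environment of a pair: for `a ≠ b` in `K ⊂ ℤ*`,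
`Σ_{i ∈ ℤ* ∖ {a,b}} = Σ_{i ∈ K ∖ {a,b}} + Σ_{i ∈ ℤ* ∖ K}` for the cross terms (all sums absolutely
convergent, `t > Λ`). [cite: RodgersTaoFMP2020, Lemma 12 p. 30] -/
theorem rodgersTaoCrossSum_pair_eq {t : ℝ}
    (hΛ : ∃ t₁ : ℝ, t₁ < t ∧ HasOnlyRealZeros (deBruijnH t₁)) {K : Finset ℤ} (hK : (0 : ℤ) ∉ K)
    {a b : ℤ} (ha : a ∈ K) (hb : b ∈ K) :
    rodgersTaoCrossSum t {a, b} a b =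
      ∑ i ∈ (K.erase a).erase b, rodgersTaoCrossTerm t a b i + rodgersTaoCrossSum t K a b := by
  classical
  have hsum := summable_rodgersTaoCrossTerm_int hΛ a b
  have hset : zstarCompl ({a, b} : Finset ℤ) =
      (((K.erase a).erase b : Finset ℤ) : Set ℤ) ∪ zstarCompl K := by
    ext i
    simp only [mem_zstarCompl, Finset.mem_insert, Finset.mem_singleton, Set.mem_union,
      Finset.coe_erase, Set.mem_sdiff, Finset.mem_coe, Set.mem_singleton_iff]
    constructor
    · rintro ⟨hi0, hi⟩
      by_cases hiK : i ∈ K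
      · left; exact ⟨⟨hiK, fun h ↦ hi (Or.inl h)⟩, fun h ↦ hi (Or.inr h)⟩
      · right; exact ⟨hi0, hiK⟩
    · rintro (⟨⟨hiK, hia⟩, hib⟩ | ⟨hi0, hiK⟩)
      · exact ⟨fun h ↦ hK (h ▸ hiK), fun h ↦ h.elim hia hib⟩
      · exact ⟨hi0, fun h ↦ hiK (h.elim (fun h ↦ h ▸ ha) (fun h ↦ h ▸ hb))⟩
  have hdisj : Disjoint ((((K.erase a).erase b : Finset ℤ) : Set ℤ)) (zstarCompl K) := by
    rw [Set.disjoint_left]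
    intro i hi hi'
    rw [Finset.mem_coe] at hi
    exact hi'.2 (Finset.mem_of_mem_erase (Finset.mem_of_mem_erase hi))
  rw [rodgersTaoCrossSum_eq, rodgersTaoCrossSum_eq, tsum_congr_set_coe _ hset,
    (hsum.subtype _).tsum_union_disjoint hdisj (hsum.subtype _), Finset.tsum_subtype']

/-- From offDiag/erase sums to a sum over the cube `K³`: if `f a b a = f a b b = 0`, then
`Σ_{(a,b) ∈ K.offDiag} Σ_{i ∈ K ∖ {a,b}} f a b i = Σ_{a,b,i ∈ K} [a ≠ b] f a b i`. [folklore] -/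
private theorem sum_offDiag_erase_eq_sum_cube (K : Finset ℤ) (f : ℤ → ℤ → ℤ → ℝ)
    (hfa : ∀ a b, f a b a = 0) (hfb : ∀ a b, f a b b = 0) :
    ∑ p ∈ K.offDiag, ∑ i ∈ (K.erase p.1).erase p.2, f p.1 p.2 i =
      ∑ a ∈ K, ∑ b ∈ K, ∑ i ∈ K, if a = b then 0 else f a b i := by
  have hinner : ∀ a b, ∑ i ∈ (K.erase a).erase b, f a b i = ∑ i ∈ K, f a b i := fun a b ↦ by
    rw [Finset.sum_erase (f := fun i ↦ f a b i) _ (hfb a b),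
      Finset.sum_erase (f := fun i ↦ f a b i) _ (hfa a b)]
  simp_rw [hinner]
  have hoff : K.offDiag = (K ×ˢ K).filter (fun p ↦ p.1 ≠ p.2) := by
    ext p
    simp only [Finset.mem_offDiag, Finset.mem_filter, Finset.mem_product, and_assoc]
  rw [hoff, Finset.sum_filter, Finset.sum_product]
  refine Finset.sum_congr rfl fun a _ ↦ Finset.sum_congr rfl fun b _ ↦ ?_
  by_cases hab : a = b
  · rw [if_neg (not_not.2 hab)]
    simp [hab]
  · rw [if_pos hab]
    simp [hab]

/-- Cyclic relabelling of a sum over the cube `K³`. [folklore] -/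
private theorem sum_cube_cyclic (K : Finset ℤ) (G : ℤ → ℤ → ℤ → ℝ) :
    ∑ a ∈ K, ∑ b ∈ K, ∑ i ∈ K, G a b i = ∑ a ∈ K, ∑ b ∈ K, ∑ i ∈ K, G b i a := by
  conv_rhs => rw [Finset.sum_comm]
  exact Finset.sum_congr rfl fun b _ ↦ Finset.sum_comm

/-- Threefold symmetrisation over the cube: `3 Σ G = Σ (G + G∘σ + G∘σ²)` for the cyclic shift `σ`.
[folklore] -/
private theorem three_mul_sum_cube (K : Finset ℤ) (G : ℤ → ℤ → ℤ → ℝ) :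
    3 * ∑ a ∈ K, ∑ b ∈ K, ∑ i ∈ K, G a b i =
      ∑ a ∈ K, ∑ b ∈ K, ∑ i ∈ K, (G a b i + G b i a + G i a b) := by
  have h1 := sum_cube_cyclic K G
  have h2 := sum_cube_cyclic K (fun a b i ↦ G b i a)
  simp only [Finset.sum_add_distrib]
  linarith

/-- **The vanishing triple sum** (source, proof of (v), p. 33: "the summand antisymmetrizes to
zero"): `Σ_{k,k',k'' ∈ K distinct} 1/((x_{k''} − x_k)(x_{k''} − x_{k'})) = 0` (`t > Λ`).
[cite: RodgersTaoFMP2020, Lemma 12 (v) p. 33] -/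
theorem sum_offDiag_sum_rodgersTaoCrossTerm_eq_zero {t : ℝ}
    (hΛ : ∃ t₁ : ℝ, t₁ < t ∧ HasOnlyRealZeros (deBruijnH t₁)) (K : Finset ℤ) :
    ∑ p ∈ K.offDiag, ∑ i ∈ (K.erase p.1).erase p.2, rodgersTaoCrossTerm t p.1 p.2 i = 0 := by
  rw [sum_offDiag_erase_eq_sum_cube K (fun a b i ↦ rodgersTaoCrossTerm t a b i)
    (fun a b ↦ by simp [rodgersTaoCrossTerm_eq]) (fun a b ↦ by simp [rodgersTaoCrossTerm_eq])]
  set G : ℤ → ℤ → ℤ → ℝ := fun a b i ↦ if a = b then 0 else rodgersTaoCrossTerm t a b i with hG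
  have hcyc : ∀ a b i, G a b i + G b i a + G i a b = 0 := by
    intro a b i
    simp only [hG, rodgersTaoCrossTerm_eq]
    by_cases hab : a = b
    · subst hab
      by_cases hai : a = i
      · subst hai; simp
      · simp [sub_self]
    by_cases hbi : b = i
    · subst hbi; simp [hab, sub_self]
    by_cases hia : i = a
    · subst hia; simp [sub_self]
    rw [if_neg hab, if_neg hbi, if_neg hia]
    have h1 := deBruijnZeroZ_sub_ne_zero hΛ hab
    have h2 := deBruijnZeroZ_sub_ne_zero hΛ hbi
    have h3 := deBruijnZeroZ_sub_ne_zero hΛ hia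
    have h1' := deBruijnZeroZ_sub_ne_zero hΛ (Ne.symm hab)
    have h2' := deBruijnZeroZ_sub_ne_zero hΛ (Ne.symm hbi)
    have h3' := deBruijnZeroZ_sub_ne_zero hΛ (Ne.symm hia)
    field_simp
    ring
  have h3 := three_mul_sum_cube K G
  simp only [hcyc, Finset.sum_const_zero] at h3
  linarith

/-- **The virial triple sum** (source, proof of (iv), p. 33: "the numerator antisymmetrizes to
`−(x_{k''} − x_k)(x_{k''} − x_{k'})(x_k − x_{k'})`"):
`Σ_{k,k',k'' ∈ K distinct} (x_k − x_{k'})²/((x_{k''} − x_k)(x_{k''} − x_{k'}))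
 = −|K|(|K| − 1)(|K| − 2)` (`t > Λ`). [cite: RodgersTaoFMP2020, Lemma 12 (iv) p. 33] -/
theorem sum_offDiag_sq_mul_sum_rodgersTaoCrossTerm {t : ℝ}
    (hΛ : ∃ t₁ : ℝ, t₁ < t ∧ HasOnlyRealZeros (deBruijnH t₁)) (K : Finset ℤ) :
    ∑ p ∈ K.offDiag, ((deBruijnZeroZ t p.1 - deBruijnZeroZ t p.2) ^ 2 *
        ∑ i ∈ (K.erase p.1).erase p.2, rodgersTaoCrossTerm t p.1 p.2 i) =
      -((K.card : ℝ) * ((K.card : ℝ) - 1) * ((K.card : ℝ) - 2)) := by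
  have hmul : ∀ p ∈ K.offDiag, (deBruijnZeroZ t p.1 - deBruijnZeroZ t p.2) ^ 2 *
      ∑ i ∈ (K.erase p.1).erase p.2, rodgersTaoCrossTerm t p.1 p.2 i =
      ∑ i ∈ (K.erase p.1).erase p.2,
        (deBruijnZeroZ t p.1 - deBruijnZeroZ t p.2) ^ 2 * rodgersTaoCrossTerm t p.1 p.2 i :=
    fun p _ ↦ Finset.mul_sum _ _ _
  rw [Finset.sum_congr rfl hmul,
    sum_offDiag_erase_eq_sum_cube K
      (fun a b i ↦ (deBruijnZeroZ t a - deBruijnZeroZ t b) ^ 2 * rodgersTaoCrossTerm t a b i)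
      (fun a b ↦ by simp [rodgersTaoCrossTerm_eq]) (fun a b ↦ by simp [rodgersTaoCrossTerm_eq])]
  set G : ℤ → ℤ → ℤ → ℝ := fun a b i ↦ if a = b then 0 else
    (deBruijnZeroZ t a - deBruijnZeroZ t b) ^ 2 * rodgersTaoCrossTerm t a b i with hG
  -- the indicator of distinct triples
  set D : ℤ → ℤ → ℤ → ℝ := fun a b i ↦ if a ≠ b ∧ b ≠ i ∧ i ≠ a then 1 else 0 with hD
  have hcyc : ∀ a b i, G a b i + G b i a + G i a b = -3 * D a b i := by
    intro a b i
    simp only [hG, hD, rodgersTaoCrossTerm_eq]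
    by_cases hab : a = b
    · subst hab
      by_cases hai : a = i
      · subst hai; simp
      · simp [sub_self]
    by_cases hbi : b = i
    · subst hbi; simp [hab, sub_self]
    by_cases hia : i = a
    · subst hia; simp [sub_self]
    rw [if_neg hab, if_neg hbi, if_neg hia, if_pos ⟨hab, hbi, hia⟩]
    have h1 := deBruijnZeroZ_sub_ne_zero hΛ hab
    have h2 := deBruijnZeroZ_sub_ne_zero hΛ hbi
    have h3 := deBruijnZeroZ_sub_ne_zero hΛ hia
    have h1' := deBruijnZeroZ_sub_ne_zero hΛ (Ne.symm hab)
    have h2' := deBruijnZeroZ_sub_ne_zero hΛ (Ne.symm hbi)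
    have h3' := deBruijnZeroZ_sub_ne_zero hΛ (Ne.symm hia)
    field_simp
    ring
  -- counting the distinct triples
  have hcount : ∑ a ∈ K, ∑ b ∈ K, ∑ i ∈ K, D a b i =
      (K.card : ℝ) * ((K.card : ℝ) - 1) * ((K.card : ℝ) - 2) := by
    have hi : ∀ a ∈ K, ∀ b ∈ K, a ≠ b → ∑ i ∈ K, D a b i = (K.card : ℝ) - 2 := by
      intro a ha b hb hab
      have hfilt : K.filter (fun i ↦ a ≠ b ∧ b ≠ i ∧ i ≠ a) = (K.erase a).erase b := by
        ext i
        simp only [Finset.mem_filter, Finset.mem_erase]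
        tauto
      have hsum : ∑ i ∈ K, D a b i = (((K.erase a).erase b).card : ℝ) := by
        simp only [hD]
        rw [Finset.sum_boole, hfilt]
      have hc1 := Finset.card_erase_add_one (Finset.mem_erase.2 ⟨Ne.symm hab, hb⟩)
      have hc2 := Finset.card_erase_add_one ha
      have hc : (((K.erase a).erase b).card : ℝ) + 2 = K.card := by
        exact_mod_cast (show ((K.erase a).erase b).card + 2 = K.card by omega)
      rw [hsum]
      linarith
    have hb' : ∀ a ∈ K, ∑ b ∈ K, ∑ i ∈ K, D a b i = ((K.card : ℝ) - 1) * ((K.card : ℝ) - 2) := by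
      intro a ha
      have hab0 : ∑ i ∈ K, D a a i = 0 := Finset.sum_eq_zero fun i _ ↦ by simp [hD]
      rw [← Finset.add_sum_erase _ _ ha, hab0, zero_add,
        Finset.sum_congr rfl fun b hb ↦ hi a ha b (Finset.mem_of_mem_erase hb)
          (Finset.ne_of_mem_erase hb).symm, Finset.sum_const, nsmul_eq_mul]
      have hc : ((K.erase a).card : ℝ) + 1 = K.card := by
        exact_mod_cast Finset.card_erase_add_one ha
      have : ((K.erase a).card : ℝ) = K.card - 1 := by linarith
      rw [this]
    rw [Finset.sum_congr rfl hb', Finset.sum_const, nsmul_eq_mul]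
    ring
  have h3 := three_mul_sum_cube K G
  simp only [hcyc] at h3
  have hD3 : ∑ a ∈ K, ∑ b ∈ K, ∑ i ∈ K, -3 * D a b i =
      -3 * ∑ a ∈ K, ∑ b ∈ K, ∑ i ∈ K, D a b i := by
    simp only [Finset.mul_sum]
  rw [hD3, hcount] at h3
  linarith


/-- The derivative of one gap `x_a − x_b` (`a ≠ b` in `ℤ*`, `t > Λ`), from Lemma 12 (i).
[cite: RodgersTaoFMP2020, Lemma 12 (i) p. 30] -/
theorem hasDerivAt_gap {t : ℝ} (hΛ : ∃ t₁ : ℝ, t₁ < t ∧ HasOnlyRealZeros (deBruijnH t₁))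
    {a b : ℤ} (ha : a ≠ 0) (hb : b ≠ 0) (hab : a ≠ b) :
    HasDerivAt (fun s ↦ deBruijnZeroZ s a - deBruijnZeroZ s b)
      (4 / (deBruijnZeroZ t a - deBruijnZeroZ t b) -
        2 * (deBruijnZeroZ t a - deBruijnZeroZ t b) * rodgersTaoCrossSum t {a, b} a b) t :=
  (rodgers_tao_gap_dynamics_holds t hΛ b a hb ha hab.symm).2

/-- The derivative of one Hamiltonian interaction: `∂ₜ H_{ab} = −4 E_{ab} + 2 Σ_{i ≠ a,b}
1/((x_i − x_a)(x_i − x_b))` (`a ≠ b` in `ℤ*`, `t > Λ`; source p. 33: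
"`−Σ ∂ₜ(x_k − x_{k'})/(x_k − x_{k'})` which by (i) becomes …").
[cite: RodgersTaoFMP2020, Lemma 12 (v) p. 33] -/
theorem hasDerivAt_hamiltonianInteraction {t : ℝ}
    (hΛ : ∃ t₁ : ℝ, t₁ < t ∧ HasOnlyRealZeros (deBruijnH t₁)) {a b : ℤ} (ha : a ≠ 0) (hb : b ≠ 0)
    (hab : a ≠ b) :
    HasDerivAt (fun s ↦ hamiltonianInteraction s a b)
      (-4 * interactionEnergy t a b + 2 * rodgersTaoCrossSum t {a, b} a b) t := by
  have hu := hasDerivAt_gap hΛ ha hb hab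
  have hu0 : deBruijnZeroZ t a - deBruijnZeroZ t b ≠ 0 := deBruijnZeroZ_sub_ne_zero hΛ hab.symm
  have hfun : (fun s ↦ hamiltonianInteraction s a b) =
      fun s ↦ -Real.log (deBruijnZeroZ s a - deBruijnZeroZ s b) := by
    funext s
    rw [hamiltonianInteraction_eq_neg_log, Real.log_abs]
  rw [hfun]
  have h := ((Real.hasDerivAt_log hu0).comp t hu).neg
  refine h.congr_deriv ?_
  rw [interactionEnergy_eq]
  field_simp
  ring

/-- The derivative of one squared gap: `∂ₜ (x_a − x_b)² = 8 − 4 (x_a − x_b)² Σ_{i ≠ a,b}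
1/((x_i − x_a)(x_i − x_b))` (`a ≠ b` in `ℤ*`, `t > Λ`; source p. 33).
[cite: RodgersTaoFMP2020, Lemma 12 (iv) p. 33] -/
theorem hasDerivAt_gap_sq {t : ℝ}
    (hΛ : ∃ t₁ : ℝ, t₁ < t ∧ HasOnlyRealZeros (deBruijnH t₁)) {a b : ℤ} (ha : a ≠ 0) (hb : b ≠ 0)
    (hab : a ≠ b) :
    HasDerivAt (fun s ↦ (deBruijnZeroZ s a - deBruijnZeroZ s b) ^ 2)
      (8 - 4 * (deBruijnZeroZ t a - deBruijnZeroZ t b) ^ 2 * rodgersTaoCrossSum t {a, b} a b)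
      t := by
  have hu := hasDerivAt_gap hΛ ha hb hab
  have hu0 : deBruijnZeroZ t a - deBruijnZeroZ t b ≠ 0 := deBruijnZeroZ_sub_ne_zero hΛ hab.symm
  refine (hu.pow 2).congr_deriv ?_
  simp only [Nat.cast_ofNat, pow_one, Nat.add_one_sub_one]
  field_simp
  ring

/-- **Rodgers–Tao 2020, Lemma 12 (v) (= Lemma 4.2 (v)), the Hamiltonian identity, discharged**:
`∂ₜ Σ_{k ≠ k' ∈ K} H_{kk'} = −4 Σ_{k ≠ k' ∈ K} E_{kk'}
 + 2 Σ_{k ≠ k' ∈ K} Σ_{j ∉ K} 1/((x_j − x_k)(x_j − x_{k'}))` for every `t > Λ` and finite `K ⊂ ℤ*`.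
CONTENT discharge following the printed proof (p. 33): differentiate each
`H_{kk'} = −log|x_k − x_{k'}|` by (i) (`hasDerivAt_hamiltonianInteraction`), split the environment
`ℤ* ∖ {k,k'} = (K ∖ {k,k'}) ⊔ (ℤ* ∖ K)` (`rodgersTaoCrossSum_pair_eq`), and observe that the triple
sum over `K` "antisymmetrizes to zero"
(`sum_offDiag_sum_rodgersTaoCrossTerm_eq_zero`). [cite: RodgersTaoFMP2020, Lemma 12 (v) p. 30] -/
theorem rodgers_tao_hamiltonian_identity_holds : rodgers_tao_hamiltonian_identity := by
  intro t hΛ K hK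
  refine ⟨fun p _ ↦ (summable_rodgersTaoCrossTerm_int hΛ p.1 p.2).subtype _, ?_⟩
  have hmem : ∀ p ∈ K.offDiag, p.1 ∈ K ∧ p.2 ∈ K ∧ p.1 ≠ p.2 := fun p hp ↦ Finset.mem_offDiag.1 hp
  have hterm : ∀ p ∈ K.offDiag, HasDerivAt (fun s ↦ hamiltonianInteraction s p.1 p.2)
      (-4 * interactionEnergy t p.1 p.2 + 2 * rodgersTaoCrossSum t {p.1, p.2} p.1 p.2) t := by
    intro p hp
    obtain ⟨h1, h2, h12⟩ := hmem p hp
    exact hasDerivAt_hamiltonianInteraction hΛ (fun h ↦ hK (h ▸ h1)) (fun h ↦ hK (h ▸ h2)) h12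
  have hsum : HasDerivAt (fun s ↦ ∑ p ∈ K.offDiag, hamiltonianInteraction s p.1 p.2)
      (∑ p ∈ K.offDiag,
        (-4 * interactionEnergy t p.1 p.2 + 2 * rodgersTaoCrossSum t {p.1, p.2} p.1 p.2)) t := by
    exact HasDerivAt.fun_sum hterm
  refine hsum.congr_deriv ?_
  have hsplit : ∀ p ∈ K.offDiag, rodgersTaoCrossSum t {p.1, p.2} p.1 p.2 =
      ∑ i ∈ (K.erase p.1).erase p.2, rodgersTaoCrossTerm t p.1 p.2 i +
        rodgersTaoCrossSum t K p.1 p.2 := fun p hp ↦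
    rodgersTaoCrossSum_pair_eq hΛ hK (hmem p hp).1 (hmem p hp).2.1
  rw [Finset.sum_add_distrib, ← Finset.mul_sum, ← Finset.mul_sum, Finset.sum_congr rfl hsplit,
    Finset.sum_add_distrib, sum_offDiag_sum_rodgersTaoCrossTerm_eq_zero hΛ K, zero_add]

/-- **Rodgers–Tao 2020, Lemma 12 (iv) (= Lemma 4.2 (iv)), the virial identity, discharged**:
`∂ₜ Σ_{k ≠ k' ∈ K} (x_k − x_{k'})² = 4|K|²(|K| − 1) − Σ_{k ≠ k' ∈ K} (x_k − x_{k'})² Σ_{j ∉ K}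
4/((x_k − x_j)(x_{k'} − x_j))` for every `t > Λ` and finite `K ⊂ ℤ*`. CONTENT discharge following
the printed proof (p. 33): differentiate each squared gap by (i) (`hasDerivAt_gap_sq`), split the
environment (`rodgersTaoCrossSum_pair_eq`), and evaluate the triple sum over `K` to
`−|K|(|K| − 1)(|K| − 2)` (`sum_offDiag_sq_mul_sum_rodgersTaoCrossTerm`); with `#K.offDiag =
|K|(|K| − 1)` this gives `8|K|(|K| − 1) + 4|K|(|K| − 1)(|K| − 2) = 4|K|²(|K| − 1)`.
[cite: RodgersTaoFMP2020, Lemma 12 (iv) p. 30] -/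
theorem rodgers_tao_virial_identity_holds : rodgers_tao_virial_identity := by
  intro t hΛ K hK
  refine ⟨fun p _ ↦ (summable_rodgersTaoCrossTerm_int hΛ p.1 p.2).subtype _, ?_⟩
  have hmem : ∀ p ∈ K.offDiag, p.1 ∈ K ∧ p.2 ∈ K ∧ p.1 ≠ p.2 := fun p hp ↦ Finset.mem_offDiag.1 hp
  have hterm : ∀ p ∈ K.offDiag, HasDerivAt (fun s ↦ (deBruijnZeroZ s p.1 - deBruijnZeroZ s p.2) ^ 2)
      (8 - 4 * (deBruijnZeroZ t p.1 - deBruijnZeroZ t p.2) ^ 2 *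
        rodgersTaoCrossSum t {p.1, p.2} p.1 p.2) t := by
    intro p hp
    obtain ⟨h1, h2, h12⟩ := hmem p hp
    exact hasDerivAt_gap_sq hΛ (fun h ↦ hK (h ▸ h1)) (fun h ↦ hK (h ▸ h2)) h12
  have hsum : HasDerivAt (fun s ↦ ∑ p ∈ K.offDiag, (deBruijnZeroZ s p.1 - deBruijnZeroZ s p.2) ^ 2)
      (∑ p ∈ K.offDiag, (8 - 4 * (deBruijnZeroZ t p.1 - deBruijnZeroZ t p.2) ^ 2 *
        rodgersTaoCrossSum t {p.1, p.2} p.1 p.2)) t := by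
    exact HasDerivAt.fun_sum hterm
  refine hsum.congr_deriv ?_
  have hsplit : ∀ p ∈ K.offDiag, (8 - 4 * (deBruijnZeroZ t p.1 - deBruijnZeroZ t p.2) ^ 2 *
      rodgersTaoCrossSum t {p.1, p.2} p.1 p.2) =
      8 + (-4) * ((deBruijnZeroZ t p.1 - deBruijnZeroZ t p.2) ^ 2 *
        ∑ i ∈ (K.erase p.1).erase p.2, rodgersTaoCrossTerm t p.1 p.2 i) +
        (-1) * ((deBruijnZeroZ t p.1 - deBruijnZeroZ t p.2) ^ 2 *
          (4 * rodgersTaoCrossSum t K p.1 p.2)) := by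
    intro p hp
    rw [rodgersTaoCrossSum_pair_eq hΛ hK (hmem p hp).1 (hmem p hp).2.1]
    ring
  rw [Finset.sum_congr rfl hsplit, Finset.sum_add_distrib, Finset.sum_add_distrib,
    ← Finset.mul_sum, ← Finset.mul_sum, sum_offDiag_sq_mul_sum_rodgersTaoCrossTerm hΛ K,
    Finset.sum_const, nsmul_eq_mul, Finset.offDiag_card]
  have hn : ((K.card * K.card - K.card : ℕ) : ℝ) = (K.card : ℝ) * K.card - K.card := by
    rw [Nat.cast_sub (Nat.le_mul_self K.card)]
    push_cast
    ring
  rw [hn]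
  ring

/-! ## Lemma 12 (iii): the energy identity

Appended (third filing): the named fact `rodgers_tao_energy_identity` (Lemma 12 (iii)) is
discharged as `rodgers_tao_energy_identity_holds` — a CONTENT discharge following the printed proof
(FMP pp. 32–33): differentiate each `E_{kk'} = (x_k − x_{k'})⁻²` by (i), split the environment,
and establish the two finite identities of the source: the four-index sum over distinct
`k,k',k'',k'''` of `1/((x_{k''} − x_k)(x_{k''} − x_{k'})(x_{k'''} − x_k)(x_{k'''} − x_{k'}))`
vanishes ("the denominator is a Vandermonde determinant … the final sum vanishes"; here: the three
pair-partitions `{kk'|k''k'''}`, `{kk''|k'k'''}`, `{kk'''|k'k''}` of a quadruple sum to zero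
pointwise), and the three-index identity `Σ f² = Σ (2/(x_k − x_{k'})²) f` ("the numerator
symmetrizes to zero"; cyclic symmetrisation over `K³`). -/

/-- The derivative of one interaction energy: `∂ₜ E_{ab} = −8/(x_a − x_b)⁴ + 4 Σ_{i ≠ a,b}
1/((x_i − x_a)(x_i − x_b)) / (x_a − x_b)²` (`a ≠ b` in `ℤ*`, `t > Λ`; source p. 32:
"`−2 Σ ∂ₜ(x_k − x_{k'})/(x_k − x_{k'})³` which by (i) becomes …").
[cite: RodgersTaoFMP2020, Lemma 12 (iii) p. 32] -/
theorem hasDerivAt_interactionEnergy {t : ℝ}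
    (hΛ : ∃ t₁ : ℝ, t₁ < t ∧ HasOnlyRealZeros (deBruijnH t₁)) {a b : ℤ} (ha : a ≠ 0) (hb : b ≠ 0)
    (hab : a ≠ b) :
    HasDerivAt (fun s ↦ interactionEnergy s a b)
      (-8 / (deBruijnZeroZ t a - deBruijnZeroZ t b) ^ 4 +
        4 * rodgersTaoCrossSum t {a, b} a b / (deBruijnZeroZ t a - deBruijnZeroZ t b) ^ 2) t := by
  have hu := hasDerivAt_gap hΛ ha hb hab
  have hu0 : deBruijnZeroZ t a - deBruijnZeroZ t b ≠ 0 := deBruijnZeroZ_sub_ne_zero hΛ hab.symm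
  have hfun : (fun s ↦ interactionEnergy s a b) =
      fun s ↦ ((deBruijnZeroZ s a - deBruijnZeroZ s b) ^ 2)⁻¹ := by
    funext s; rw [interactionEnergy_eq, one_div]
  rw [hfun]
  have h2 : HasDerivAt (fun s ↦ (deBruijnZeroZ s a - deBruijnZeroZ s b) ^ 2)
      (((2 : ℕ) : ℝ) * (deBruijnZeroZ t a - deBruijnZeroZ t b) ^ (2 - 1) *
        (4 / (deBruijnZeroZ t a - deBruijnZeroZ t b) -
          2 * (deBruijnZeroZ t a - deBruijnZeroZ t b) * rodgersTaoCrossSum t {a, b} a b)) t :=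
    hu.pow 2
  refine (h2.inv (pow_ne_zero 2 hu0)).congr_deriv ?_
  simp only [Nat.cast_ofNat, Nat.add_one_sub_one, pow_one]
  field_simp
  ring

/-- From offDiag/erase/erase sums to a sum over `K⁴`: if `f a b a = f a b b = 0`, then
`Σ_{(a,b) ∈ K.offDiag} Σ_{c ∈ K ∖ {a,b}} Σ_{d ∈ K ∖ {a,b,c}} f a b c · f a b d =
Σ_{a,b,c,d ∈ K} [a ≠ b ∧ c ≠ d] f a b c · f a b d`. [folklore] -/
private theorem sum_offDiag_erase_erase_eq_sum_four (K : Finset ℤ) (f : ℤ → ℤ → ℤ → ℝ)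
    (hfa : ∀ a b, f a b a = 0) (hfb : ∀ a b, f a b b = 0) :
    ∑ p ∈ K.offDiag, ∑ c ∈ (K.erase p.1).erase p.2, ∑ d ∈ ((K.erase p.1).erase p.2).erase c,
        f p.1 p.2 c * f p.1 p.2 d =
      ∑ a ∈ K, ∑ b ∈ K, ∑ c ∈ K, ∑ d ∈ K, if a = b ∨ c = d then 0 else f a b c * f a b d := by
  -- inner sum over `d`
  have hd : ∀ a b c, ∑ d ∈ ((K.erase a).erase b).erase c, f a b c * f a b d =
      ∑ d ∈ K, if c = d then 0 else f a b c * f a b d := by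
    intro a b c
    rw [← Finset.sum_erase (s := K) (f := fun d ↦ if c = d then 0 else f a b c * f a b d)
        (a := c) (if_pos rfl),
      ← Finset.sum_erase (s := K.erase c) (f := fun d ↦ if c = d then 0 else f a b c * f a b d)
        (a := a) (by simp [hfa]),
      ← Finset.sum_erase (s := (K.erase c).erase a)
        (f := fun d ↦ if c = d then 0 else f a b c * f a b d) (a := b) (by simp [hfb])]
    have hset : ((K.erase c).erase a).erase b = ((K.erase a).erase b).erase c := by
      ext d; simp only [Finset.mem_erase]; tauto
    rw [hset]
    exact Finset.sum_congr rfl fun d hd ↦ by rw [if_neg (Finset.ne_of_mem_erase hd).symm]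
  simp_rw [hd]
  rw [sum_offDiag_erase_eq_sum_cube K (fun a b c ↦ ∑ d ∈ K, if c = d then 0 else f a b c * f a b d)
    (fun a b ↦ Finset.sum_eq_zero fun d _ ↦ by simp [hfa])
    (fun a b ↦ Finset.sum_eq_zero fun d _ ↦ by simp [hfb])]
  refine Finset.sum_congr rfl fun a _ ↦ Finset.sum_congr rfl fun b _ ↦
    Finset.sum_congr rfl fun c _ ↦ ?_
  by_cases hab : a = b
  · simp [hab]
  · simp only [hab, false_or, if_false]

/-- **The vanishing four-index sum** (source, proof of (iii), p. 32: "The denominator is a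
Vandermonde determinant … All the monomials appearing in the numerator disappear upon
antisymmetrization, so the final sum vanishes"):
the sum over distinct `k,k',k'',k''' ∈ K` of
`1/((x_{k''} − x_k)(x_{k''} − x_{k'})(x_{k'''} − x_k)(x_{k'''} − x_{k'}))` is `0` (`t > Λ`).
[cite: RodgersTaoFMP2020, Lemma 12 (iii) p. 32] -/
theorem sum_offDiag_sum_sum_rodgersTaoCrossTerm_mul_eq_zero {t : ℝ}
    (hΛ : ∃ t₁ : ℝ, t₁ < t ∧ HasOnlyRealZeros (deBruijnH t₁)) (K : Finset ℤ) :
    ∑ p ∈ K.offDiag, ∑ c ∈ (K.erase p.1).erase p.2, ∑ d ∈ ((K.erase p.1).erase p.2).erase c,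
      rodgersTaoCrossTerm t p.1 p.2 c * rodgersTaoCrossTerm t p.1 p.2 d = 0 := by
  rw [sum_offDiag_erase_erase_eq_sum_four K (fun a b c ↦ rodgersTaoCrossTerm t a b c)
    (fun a b ↦ by simp [rodgersTaoCrossTerm_eq]) (fun a b ↦ by simp [rodgersTaoCrossTerm_eq])]
  set G : ℤ → ℤ → ℤ → ℤ → ℝ := fun a b c d ↦
    if a = b ∨ c = d then 0 else rodgersTaoCrossTerm t a b c * rodgersTaoCrossTerm t a b d with hG
  -- the two relabelled copies of the sum
  have hS2 : ∑ a ∈ K, ∑ b ∈ K, ∑ c ∈ K, ∑ d ∈ K, G a c b d =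
      ∑ a ∈ K, ∑ b ∈ K, ∑ c ∈ K, ∑ d ∈ K, G a b c d :=
    Finset.sum_congr rfl fun a _ ↦ Finset.sum_comm
  have hS3 : ∑ a ∈ K, ∑ b ∈ K, ∑ c ∈ K, ∑ d ∈ K, G a d b c =
      ∑ a ∈ K, ∑ b ∈ K, ∑ c ∈ K, ∑ d ∈ K, G a b c d := by
    refine Finset.sum_congr rfl fun a _ ↦ ?_
    calc ∑ b ∈ K, ∑ c ∈ K, ∑ d ∈ K, G a d b c
        = ∑ b ∈ K, ∑ d ∈ K, ∑ c ∈ K, G a d b c :=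
          Finset.sum_congr rfl fun b _ ↦ Finset.sum_comm
      _ = ∑ d ∈ K, ∑ b ∈ K, ∑ c ∈ K, G a d b c := Finset.sum_comm
  -- pointwise: the three pair-partitions sum to zero
  have hpt : ∀ a b c d, G a b c d + G a c b d + G a d b c = 0 := by
    intro a b c d
    simp only [hG, rodgersTaoCrossTerm_eq]
    by_cases hab : a = b
    · subst hab; simp
    by_cases hac : a = c
    · subst hac; simp
    by_cases had : a = d
    · subst had; simp
    by_cases hbc : b = c
    · subst hbc; simp
    by_cases hbd : b = d
    · subst hbd; simp
    by_cases hcd : c = d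
    · subst hcd; simp
    rw [if_neg (by tauto), if_neg (by tauto), if_neg (by tauto)]
    have h1 := deBruijnZeroZ_sub_ne_zero hΛ hab
    have h2 := deBruijnZeroZ_sub_ne_zero hΛ hac
    have h3 := deBruijnZeroZ_sub_ne_zero hΛ had
    have h4 := deBruijnZeroZ_sub_ne_zero hΛ hbc
    have h5 := deBruijnZeroZ_sub_ne_zero hΛ hbd
    have h6 := deBruijnZeroZ_sub_ne_zero hΛ hcd
    have h1' := deBruijnZeroZ_sub_ne_zero hΛ (Ne.symm hab)
    have h2' := deBruijnZeroZ_sub_ne_zero hΛ (Ne.symm hac)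
    have h3' := deBruijnZeroZ_sub_ne_zero hΛ (Ne.symm had)
    have h4' := deBruijnZeroZ_sub_ne_zero hΛ (Ne.symm hbc)
    have h5' := deBruijnZeroZ_sub_ne_zero hΛ (Ne.symm hbd)
    have h6' := deBruijnZeroZ_sub_ne_zero hΛ (Ne.symm hcd)
    field_simp
    ring
  have h3 : 3 * ∑ a ∈ K, ∑ b ∈ K, ∑ c ∈ K, ∑ d ∈ K, G a b c d =
      ∑ a ∈ K, ∑ b ∈ K, ∑ c ∈ K, ∑ d ∈ K, (G a b c d + G a c b d + G a d b c) := by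
    simp only [Finset.sum_add_distrib]
    linarith
  simp only [hpt, Finset.sum_const_zero] at h3
  linarith

/-- **The three-index identity** (source, proof of (iii), p. 33: "The denominator is totally
symmetric in `k, k', k''`, while the numerator symmetrizes to zero"):
`Σ_{k ≠ k'} Σ_{k'' ≠ k,k'} 1/((x_{k''} − x_k)²(x_{k''} − x_{k'})²)
 = Σ_{k ≠ k'} (2/(x_k − x_{k'})²) Σ_{k'' ≠ k,k'} 1/((x_{k''} − x_k)(x_{k''} − x_{k'}))` (`t > Λ`).
[cite: RodgersTaoFMP2020, Lemma 12 (iii) p. 33] -/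
theorem sum_offDiag_sum_rodgersTaoCrossTerm_sq {t : ℝ}
    (hΛ : ∃ t₁ : ℝ, t₁ < t ∧ HasOnlyRealZeros (deBruijnH t₁)) (K : Finset ℤ) :
    ∑ p ∈ K.offDiag, ∑ c ∈ (K.erase p.1).erase p.2, rodgersTaoCrossTerm t p.1 p.2 c ^ 2 =
      ∑ p ∈ K.offDiag, (2 / (deBruijnZeroZ t p.1 - deBruijnZeroZ t p.2) ^ 2 *
        ∑ c ∈ (K.erase p.1).erase p.2, rodgersTaoCrossTerm t p.1 p.2 c) := by
  rw [← sub_eq_zero, ← Finset.sum_sub_distrib]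
  have hre : ∀ p ∈ K.offDiag, ∑ c ∈ (K.erase p.1).erase p.2, rodgersTaoCrossTerm t p.1 p.2 c ^ 2 -
      2 / (deBruijnZeroZ t p.1 - deBruijnZeroZ t p.2) ^ 2 *
        ∑ c ∈ (K.erase p.1).erase p.2, rodgersTaoCrossTerm t p.1 p.2 c =
      ∑ c ∈ (K.erase p.1).erase p.2, (rodgersTaoCrossTerm t p.1 p.2 c ^ 2 -
        2 / (deBruijnZeroZ t p.1 - deBruijnZeroZ t p.2) ^ 2 * rodgersTaoCrossTerm t p.1 p.2 c) := by
    intro p _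
    rw [Finset.sum_sub_distrib, Finset.mul_sum]
  rw [Finset.sum_congr rfl hre,
    sum_offDiag_erase_eq_sum_cube K
      (fun a b c ↦ rodgersTaoCrossTerm t a b c ^ 2 -
        2 / (deBruijnZeroZ t a - deBruijnZeroZ t b) ^ 2 * rodgersTaoCrossTerm t a b c)
      (fun a b ↦ by simp [rodgersTaoCrossTerm_eq]) (fun a b ↦ by simp [rodgersTaoCrossTerm_eq])]
  set G : ℤ → ℤ → ℤ → ℝ := fun a b c ↦ if a = b then 0 else
    (rodgersTaoCrossTerm t a b c ^ 2 -
      2 / (deBruijnZeroZ t a - deBruijnZeroZ t b) ^ 2 * rodgersTaoCrossTerm t a b c) with hG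
  have hcyc : ∀ a b c, G a b c + G b c a + G c a b = 0 := by
    intro a b c
    simp only [hG, rodgersTaoCrossTerm_eq]
    by_cases hab : a = b
    · subst hab
      by_cases hac : a = c
      · subst hac; simp
      · simp [sub_self]
    by_cases hbc : b = c
    · subst hbc; simp [hab, sub_self]
    by_cases hca : c = a
    · subst hca; simp [sub_self]
    rw [if_neg hab, if_neg hbc, if_neg hca]
    have h1 := deBruijnZeroZ_sub_ne_zero hΛ hab
    have h2 := deBruijnZeroZ_sub_ne_zero hΛ hbc
    have h3 := deBruijnZeroZ_sub_ne_zero hΛ hca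
    have h1' := deBruijnZeroZ_sub_ne_zero hΛ (Ne.symm hab)
    have h2' := deBruijnZeroZ_sub_ne_zero hΛ (Ne.symm hbc)
    have h3' := deBruijnZeroZ_sub_ne_zero hΛ (Ne.symm hca)
    field_simp
    ring
  have h3 := three_mul_sum_cube K G
  simp only [hcyc, Finset.sum_const_zero] at h3
  linarith

/-- Squaring a finite sum: `(Σ_{c} f c)² = Σ_c f c² + Σ_c Σ_{d ≠ c} f c f d`. [folklore] -/
private theorem sq_sum_eq (S : Finset ℤ) (f : ℤ → ℝ) :
    (∑ c ∈ S, f c) ^ 2 = ∑ c ∈ S, f c ^ 2 + ∑ c ∈ S, ∑ d ∈ S.erase c, f c * f d := by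
  rw [sq, Finset.sum_mul_sum, ← Finset.sum_add_distrib]
  refine Finset.sum_congr rfl fun c hc ↦ ?_
  rw [← Finset.add_sum_erase _ _ hc, sq]

/-- **Rodgers–Tao 2020, Lemma 12 (iii) (= Lemma 4.2 (iii)), the energy identity, discharged**:
`∂ₜ Σ_{k ≠ k' ∈ K} E_{kk'} = Σ_{k ≠ k'} Σ_{j ∉ K} 4/((x_k − x_{k'})²(x_k − x_j)(x_{k'} − x_j))
 − 2 Σ_{k ≠ k'} (2/(x_k − x_{k'})² − Σ_{k'' ≠ k,k'} 1/((x_{k''} − x_k)(x_{k''} − x_{k'})))²`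
for every `t > Λ` and finite `K ⊂ ℤ*`. CONTENT discharge following the printed proof
(pp. 32–33): termwise derivative by (i) (`hasDerivAt_interactionEnergy`), environment split
(`rodgersTaoCrossSum_pair_eq`), then the square is expanded and the two finite identities
`sum_offDiag_sum_sum_rodgersTaoCrossTerm_mul_eq_zero` (four-index, "Vandermonde") and
`sum_offDiag_sum_rodgersTaoCrossTerm_sq` (three-index) close the computation.
[cite: RodgersTaoFMP2020, Lemma 12 (iii) p. 30] -/
theorem rodgers_tao_energy_identity_holds : rodgers_tao_energy_identity := by
  intro t hΛ K hK
  refine ⟨fun p _ ↦ (summable_rodgersTaoCrossTerm_int hΛ p.1 p.2).subtype _, ?_⟩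
  have hmem : ∀ p ∈ K.offDiag, p.1 ∈ K ∧ p.2 ∈ K ∧ p.1 ≠ p.2 := fun p hp ↦ Finset.mem_offDiag.1 hp
  have hterm : ∀ p ∈ K.offDiag, HasDerivAt (fun s ↦ interactionEnergy s p.1 p.2)
      (-8 / (deBruijnZeroZ t p.1 - deBruijnZeroZ t p.2) ^ 4 +
        4 * rodgersTaoCrossSum t {p.1, p.2} p.1 p.2 /
          (deBruijnZeroZ t p.1 - deBruijnZeroZ t p.2) ^ 2) t := by
    intro p hp
    obtain ⟨h1, h2, h12⟩ := hmem p hp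
    exact hasDerivAt_interactionEnergy hΛ (fun h ↦ hK (h ▸ h1)) (fun h ↦ hK (h ▸ h2)) h12
  have hsum : HasDerivAt (fun s ↦ ∑ p ∈ K.offDiag, interactionEnergy s p.1 p.2)
      (∑ p ∈ K.offDiag, (-8 / (deBruijnZeroZ t p.1 - deBruijnZeroZ t p.2) ^ 4 +
        4 * rodgersTaoCrossSum t {p.1, p.2} p.1 p.2 /
          (deBruijnZeroZ t p.1 - deBruijnZeroZ t p.2) ^ 2)) t := by
    exact HasDerivAt.fun_sum hterm
  refine hsum.congr_deriv ?_
  -- abbreviation: `T p` the environment sum of the pair `p` over `K`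
  set T : ℤ × ℤ → ℝ := fun p ↦
    ∑ c ∈ (K.erase p.1).erase p.2, rodgersTaoCrossTerm t p.1 p.2 c with hT
  have hTdef : ∀ p : ℤ × ℤ, ∑ i ∈ (K.erase p.1).erase p.2,
      1 / ((deBruijnZeroZ t i - deBruijnZeroZ t p.1) * (deBruijnZeroZ t i - deBruijnZeroZ t p.2)) =
      T p := fun p ↦ rfl
  simp only [hTdef]
  have hsplit : ∀ p ∈ K.offDiag, rodgersTaoCrossSum t {p.1, p.2} p.1 p.2 =
      T p + rodgersTaoCrossSum t K p.1 p.2 := fun p hp ↦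
    rodgersTaoCrossSum_pair_eq hΛ hK (hmem p hp).1 (hmem p hp).2.1
  have hsq : ∀ p ∈ K.offDiag, T p ^ 2 =
      ∑ c ∈ (K.erase p.1).erase p.2, rodgersTaoCrossTerm t p.1 p.2 c ^ 2 +
        ∑ c ∈ (K.erase p.1).erase p.2, ∑ d ∈ ((K.erase p.1).erase p.2).erase c,
          rodgersTaoCrossTerm t p.1 p.2 c * rodgersTaoCrossTerm t p.1 p.2 d := fun p _ ↦
    sq_sum_eq _ _
  have hα := sum_offDiag_sum_sum_rodgersTaoCrossTerm_mul_eq_zero hΛ K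
  have hβ := sum_offDiag_sum_rodgersTaoCrossTerm_sq hΛ K
  rw [← sub_eq_zero] at hβ
  rw [← Finset.sum_sub_distrib] at hβ
  -- pointwise: derivative term minus target term
  have hpt : ∀ p ∈ K.offDiag,
      (-8 / (deBruijnZeroZ t p.1 - deBruijnZeroZ t p.2) ^ 4 +
        4 * rodgersTaoCrossSum t {p.1, p.2} p.1 p.2 /
          (deBruijnZeroZ t p.1 - deBruijnZeroZ t p.2) ^ 2) -
      (4 / (deBruijnZeroZ t p.1 - deBruijnZeroZ t p.2) ^ 2 * rodgersTaoCrossSum t K p.1 p.2 -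
        2 * (2 / (deBruijnZeroZ t p.1 - deBruijnZeroZ t p.2) ^ 2 - T p) ^ 2) =
      2 * (∑ c ∈ (K.erase p.1).erase p.2, rodgersTaoCrossTerm t p.1 p.2 c ^ 2 -
          2 / (deBruijnZeroZ t p.1 - deBruijnZeroZ t p.2) ^ 2 *
            ∑ c ∈ (K.erase p.1).erase p.2, rodgersTaoCrossTerm t p.1 p.2 c) +
        2 * ∑ c ∈ (K.erase p.1).erase p.2, ∑ d ∈ ((K.erase p.1).erase p.2).erase c,
          rodgersTaoCrossTerm t p.1 p.2 c * rodgersTaoCrossTerm t p.1 p.2 d := by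
    intro p hp
    have hu0 : deBruijnZeroZ t p.1 - deBruijnZeroZ t p.2 ≠ 0 :=
      deBruijnZeroZ_sub_ne_zero hΛ (hmem p hp).2.2.symm
    have hTp : ∑ c ∈ (K.erase p.1).erase p.2, rodgersTaoCrossTerm t p.1 p.2 c = T p := rfl
    rw [hsplit p hp, hTp]
    have e : (2 / (deBruijnZeroZ t p.1 - deBruijnZeroZ t p.2) ^ 2 - T p) ^ 2 =
        4 / (deBruijnZeroZ t p.1 - deBruijnZeroZ t p.2) ^ 4 -
          4 / (deBruijnZeroZ t p.1 - deBruijnZeroZ t p.2) ^ 2 * T p + T p ^ 2 := by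
      field_simp
      ring
    rw [e, hsq p hp]
    field_simp
    ring
  rw [← sub_eq_zero, Finset.mul_sum, ← Finset.sum_sub_distrib, ← Finset.sum_sub_distrib,
    Finset.sum_congr rfl hpt, Finset.sum_add_distrib, ← Finset.mul_sum, ← Finset.mul_sum, hα, hβ]
  ring

/-! ## Lemma 12 (ii): the cross-energy inequality

Appended (fourth filing): the named fact `rodgers_tao_cross_energy_inequality` (Lemma 12 (ii)) is
discharged as `rodgers_tao_cross_energy_inequality_holds` — a CONTENT discharge following the
printed proof (FMP pp. 31–32) step by step: "By monotone convergence, it suffices to show" the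
inequality with the outside index `j` restricted to a window `[−R, R]_{ℤ*} ∖ K`, `R` large
(`window_cross_energy_inequality`, then `tendsto_sum_window_sdiff`); "By the fundamental theorem of
calculus, it suffices to show" `∂ₜ Σ E_{jk} ≥ −Σ 8/(x_k − x_j)⁴` for the finite sum (Mathlib's
`intervalIntegral.integral_le_sub_of_hasDeriv_right_of_le`, the derivative of each `E_{jk}` being
`−8/(x_k − x_j)⁴ + 4 Σ_{i ≠ j,k} 1/((x_k − x_j)²(x_i − x_k)(x_i − x_j))` by (i),
`hasDerivAt_interactionEnergy`); and the coupling sum is `≥ 0` after splitting `i ∈ K`,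
`i ∈ [−R,R]_{ℤ*} ∖ K`, `i ∉ [−R,R]_{ℤ*}`: the first two parts "after symmetrising in `k` and `k'`"
(resp. `j, j'`) become `Σ 2/((x_k − x_j)²(x_{k'} − x_j)²) ≥ 0`, resp.
`Σ 2/((x_k − x_j)²(x_k − x_{j'})²) ≥ 0` (`symm_first`, `symm_second`), and "for
`i ∉ [−R,R]_{ℤ*}`, all summands are already non-negative" (`rodgersTaoCrossSum_window_nonneg`) —
`sum_window_rodgersTaoCrossSum_div_sq_nonneg`. The analytic bookkeeping the source leaves implicit
is supplied: absolute convergence of `Σ_j E_{jk}` and `Σ_j 8/(x_k − x_j)⁴` (comparison with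
`Σ 1/x_j²`), and continuity in `t` of the integrand `Σ_{k ∈ K, j ∉ K} 8/(x_k − x_j)⁴` on compact
time intervals (`continuousOn_sum_tsum_div_sub_pow_four`: the window sums converge uniformly, the
tails of `Σ_j 1/x_j(t)²` being uniformly small by Dini's theorem applied to the continuous closed
form `Σ_j 1/x_j(t)² = −H_t''(0)/(2H_t(0))`, `tsum_inv_deBruijnZero_sq_eq`, read off the Hadamard
product).

### Preparations: `Σ_j 1/x_j(t)² = −H_t''(0)/(2 H_t(0))`, its continuity, uniform tails -/

/-- `H_t'(0) = 0` (`H_t` is even: `H_t' = −S₁(t, ·)` and `S₁(t, 0) = 0`). [folklore] -/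
private theorem deriv_deBruijnH_apply_zero (t : ℝ) : deriv (deBruijnH t) 0 = 0 := by
  rw [deriv_deBruijnH]
  simp [sinMoment, sinMomentIntegrand]

/-- **The second Taylor coefficient of the Hadamard product**: for `t > Λ`,
`Σ_{j ≥ 1} 1/x_j(t)² = −H_t''(0)/(2 H_t(0))` (from `H_t(z) = H_t(0) ∏_j (1 − z²/x_j(t)²)`:
`H_t'(z)/(z H_t(z)) = Σ_j 2c_j/(1 + c_j z²) → Σ_j 2c_j = −2 Σ_j x_j⁻²` as `z → 0`, `c_j = −x_{j}⁻²`,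
while `H_t'(z)/z → H_t''(0)` since `H_t'(0) = 0`).
[cite: Polymath2019, §3 (grouped Hadamard product)] -/
theorem tsum_inv_deBruijnZero_sq_eq {t : ℝ}
    (hΛ : ∃ t₁ : ℝ, t₁ < t ∧ HasOnlyRealZeros (deBruijnH t₁)) :
    ((∑' j : ℕ, 1 / deBruijnZero t (j + 1) ^ 2 : ℝ) : ℂ) =
      -deriv (deriv (deBruijnH t)) 0 / (2 * deBruijnH t 0) := by
  have hc := isHadamardSeq_deBruijnZero hΛ
  set c : ℕ → ℂ := fun j ↦ -1 / ((deBruijnZero t (j + 1) : ℝ) : ℂ) ^ 2 with hcdef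
  have hcs : Summable fun j ↦ ‖c j‖ := hc.summable
  set M : ℝ := ∑' j, ‖c j‖ with hM
  have hM0 : 0 ≤ M := tsum_nonneg fun j ↦ norm_nonneg _
  have hcM : ∀ j, ‖c j‖ ≤ M := fun j ↦ hcs.le_tsum j fun i _ ↦ norm_nonneg _
  -- a radius on which `‖c_j z²‖ ≤ 1/2`
  set r : ℝ := 1 / (2 * (M + 1)) with hr
  have hr0 : 0 < r := by rw [hr]; positivity
  have hr1 : r ≤ 1 := by
    rw [hr, div_le_one (by positivity)]; linarith
  have hsmall : ∀ j, ∀ z : ℂ, ‖z‖ ≤ r → ‖c j * z ^ 2‖ ≤ 1 / 2 := by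
    intro j z hz
    rw [norm_mul, norm_pow]
    have hz2 : ‖z‖ ^ 2 ≤ r := by
      calc ‖z‖ ^ 2 ≤ r ^ 2 := pow_le_pow_left₀ (norm_nonneg _) hz 2
        _ ≤ r := by nlinarith
    calc ‖c j‖ * ‖z‖ ^ 2 ≤ M * r := mul_le_mul (hcM j) hz2 (by positivity) hM0
      _ = M / (2 * (M + 1)) := by rw [hr]; ring
      _ ≤ 1 / 2 := by
          rw [div_le_div_iff₀ (by positivity) (by positivity)]; nlinarith
  -- the series `L(z) = Σ 2c_j/(1 + c_j z²)`, continuous on the closed ball of radius `r`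
  set L : ℂ → ℂ := fun z ↦ ∑' j, 2 * c j / (1 + c j * z ^ 2) with hL
  have hden : ∀ j, ∀ z : ℂ, ‖z‖ ≤ r → 1 / 2 ≤ ‖1 + c j * z ^ 2‖ := by
    intro j z hz
    have := norm_sub_norm_le (1 : ℂ) (-(c j * z ^ 2))
    rw [sub_neg_eq_add, norm_neg, norm_one] at this
    linarith [hsmall j z hz]
  have hLc : ContinuousOn L (Metric.closedBall 0 r) := by
    refine continuousOn_tsum (u := fun j ↦ 4 * ‖c j‖) (fun j ↦ ?_) (hcs.mul_left 4) ?_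
    · refine ContinuousOn.div (by fun_prop) (by fun_prop) fun z hz ↦ ?_
      rw [Metric.mem_closedBall, dist_zero_right] at hz
      intro h0
      have := hden j z hz
      rw [h0, norm_zero] at this
      linarith
    · intro j z hz
      rw [Metric.mem_closedBall, dist_zero_right] at hz
      rw [norm_div, norm_mul, Complex.norm_two, div_le_iff₀ (by linarith [hden j z hz])]
      nlinarith [hden j z hz, norm_nonneg (c j)]
  have hLcont : ContinuousAt L 0 := hLc.continuousAt (Metric.closedBall_mem_nhds 0 hr0)
  -- `L(0) = −2 Σ 1/x_j²`
  have hL0 : L 0 = -2 * ((∑' j : ℕ, 1 / deBruijnZero t (j + 1) ^ 2 : ℝ) : ℂ) := by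
    simp only [hL]
    have e : ∀ j, 2 * c j / (1 + c j * (0 : ℂ) ^ 2) =
        -2 * (((1 / deBruijnZero t (j + 1) ^ 2 : ℝ)) : ℂ) := by
      intro j
      simp only [hcdef]
      push_cast
      ring
    rw [tsum_congr e, tsum_mul_left, Complex.ofReal_tsum]
  -- `H'(z)/z → H''(0)`
  have hH0 : deBruijnH t 0 ≠ 0 := deBruijnH_apply_zero_ne_zero t
  have hd : Differentiable ℂ (deBruijnH t) := differentiable_deBruijnH_holds t
  have hd' : Differentiable ℂ (deriv (deBruijnH t)) := fun w ↦
    ((hd.analyticAt w).deriv).differentiableAt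
  have h1 : Tendsto (fun z ↦ deriv (deBruijnH t) z / z) (𝓝[≠] 0)
      (𝓝 (deriv (deriv (deBruijnH t)) 0)) := by
    have := (hd' 0).hasDerivAt
    rw [hasDerivAt_iff_tendsto_slope] at this
    refine this.congr' ?_
    filter_upwards [self_mem_nhdsWithin] with z hz
    rw [slope_def_field, deriv_deBruijnH_apply_zero, sub_zero, sub_zero]
  -- `H'(z)/z = H(z) L(z)` near `0`
  have h2 : Tendsto (fun z ↦ deriv (deBruijnH t) z / z) (𝓝[≠] 0)
      (𝓝 (deBruijnH t 0 * L 0)) := by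
    have hcont : Tendsto (fun z ↦ deBruijnH t z * L z) (𝓝[≠] 0) (𝓝 (deBruijnH t 0 * L 0)) :=
      ((hd.continuous.continuousAt.mul hLcont).tendsto).mono_left nhdsWithin_le_nhds
    refine hcont.congr' ?_
    have hne : ∀ᶠ z in 𝓝 (0 : ℂ), deBruijnH t z ≠ 0 :=
      hd.continuous.continuousAt.eventually_ne hH0
    have hball : ∀ᶠ z in 𝓝 (0 : ℂ), ‖z‖ ≤ r := by
      filter_upwards [Metric.closedBall_mem_nhds (0 : ℂ) hr0] with z hz
      rwa [Metric.mem_closedBall, dist_zero_right] at hz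
    filter_upwards [eventually_nhdsWithin_of_eventually_nhds (hne.and hball),
      self_mem_nhdsWithin] with z ⟨hz, hzr⟩ hz0
    have hlog := hc.logDeriv_eq hz
    rw [logDeriv_apply] at hlog
    have hzL : ∑' j, 2 * c j * z / (1 + c j * z ^ 2) = z * L z := by
      simp only [hL]
      rw [← tsum_mul_left]
      exact tsum_congr fun j ↦ by ring
    rw [hzL, div_eq_iff hz] at hlog
    rw [eq_div_iff (show z ≠ 0 from hz0), hlog]
    ring
  have heq := tendsto_nhds_unique h1 h2
  rw [heq, hL0]
  field_simp

/-- `Σ_{j ≥ 1} 1/x_j(t)²` as a real closed form: `= Re(−H_t''(0)/(2 H_t(0)))` for `t > Λ`.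
[cite: Polymath2019, §3 (grouped Hadamard product)] -/
theorem tsum_inv_deBruijnZero_sq_eq_re {t : ℝ}
    (hΛ : ∃ t₁ : ℝ, t₁ < t ∧ HasOnlyRealZeros (deBruijnH t₁)) :
    ∑' j : ℕ, 1 / deBruijnZero t (j + 1) ^ 2 =
      (-deriv (deriv (deBruijnH t)) 0 / (2 * deBruijnH t 0)).re := by
  rw [← tsum_inv_deBruijnZero_sq_eq hΛ, Complex.ofReal_re]

/-- The closed form `t ↦ Re(−H_t''(0)/(2H_t(0)))` is continuous on `ℝ` (joint continuity of `H` and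
`H''`, `H_t(0) ≠ 0`). [folklore] -/
private theorem continuous_taylor2 :
    Continuous fun t : ℝ ↦ (-deriv (deriv (deBruijnH t)) 0 / (2 * deBruijnH t 0)).re := by
  simp only [deriv_deriv_deBruijnH, neg_neg]
  have h1 : Continuous fun t : ℝ ↦ cosMoment 2 t 0 :=
    (continuous_cosMoment_uncurry 2).comp (Continuous.prodMk_left (0 : ℂ))
  have h2 : Continuous fun t : ℝ ↦ deBruijnH t 0 :=
    continuous_deBruijnH_uncurry.comp (Continuous.prodMk_left (0 : ℂ))
  exact Complex.continuous_re.comp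
    (h1.div (continuous_const.mul h2) fun t ↦
      mul_ne_zero two_ne_zero (deBruijnH_apply_zero_ne_zero t))

/-- **Continuity of `t ↦ Σ_j 1/x_j(t)²`** on `(t₀, ∞)` whenever `H_{t₀}` has only real zeros.
[cite: Polymath2019, §3 (grouped Hadamard product)] -/
theorem continuousOn_tsum_inv_deBruijnZero_sq {t₀ : ℝ} (hreal : HasOnlyRealZeros (deBruijnH t₀)) :
    ContinuousOn (fun t ↦ ∑' j : ℕ, 1 / deBruijnZero t (j + 1) ^ 2) (Ioi t₀) := by
  refine (continuous_taylor2.continuousOn (s := Ioi t₀)).congr fun t ht ↦ ?_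
  exact tsum_inv_deBruijnZero_sq_eq_re ⟨t₀, ht, hreal⟩

/-- **Uniform tails** (Dini): on a compact time interval `[t₁, t₂] ⊂ (Λ, ∞)` the tails of
`Σ_j 1/x_j(t)²` are uniformly small: for every `ε > 0` there is `N` with
`Σ_{j ≥ N} 1/x_{j+1}(t)² < ε` for all `t ∈ [t₁, t₂]`.
[cite: RodgersTaoFMP2020, Lemma 12 (ii) p. 31] -/
theorem uniform_tail_inv_deBruijnZero_sq {t₀ t₁ t₂ : ℝ} (hreal : HasOnlyRealZeros (deBruijnH t₀))
    (h01 : t₀ < t₁) {ε : ℝ} (hε : 0 < ε) :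
    ∃ N : ℕ, ∀ n, N ≤ n → ∀ t ∈ Icc t₁ t₂,
      ∑' j : ℕ, 1 / deBruijnZero t (j + n + 1) ^ 2 < ε := by
  set F : ℕ → ℝ → ℝ := fun n t ↦ ∑ j ∈ Finset.range n, 1 / deBruijnZero t (j + 1) ^ 2 with hF
  set S : ℝ → ℝ := fun t ↦ ∑' j : ℕ, 1 / deBruijnZero t (j + 1) ^ 2 with hS
  have hsub : Icc t₁ t₂ ⊆ Ioi t₀ := fun t ht ↦ lt_of_lt_of_le h01 ht.1
  have hΛ : ∀ t ∈ Icc t₁ t₂, ∃ t' : ℝ, t' < t ∧ HasOnlyRealZeros (deBruijnH t') := fun t ht ↦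
    ⟨t₀, hsub ht, hreal⟩
  have hFc : ∀ n, ContinuousOn (F n) (Icc t₁ t₂) := by
    intro n
    refine continuousOn_finsetSum _ fun j _ ↦ ?_
    refine ContinuousOn.div continuousOn_const ((ContinuousOn.pow ?_ 2)) fun t ht ↦ ?_
    · exact fun t ht ↦ (continuousAt_deBruijnZero (hΛ t ht) (j + 1)).continuousWithinAt
    · exact pow_ne_zero 2 (deBruijnZero_pos (hΛ t ht) (by omega)).ne'
  have hmono : ∀ t ∈ Icc t₁ t₂, Monotone (F · t) := by
    intro t _ m n hmn
    exact Finset.sum_le_sum_of_subset_of_nonneg (Finset.range_mono hmn) fun j _ _ ↦ by positivity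
  have hSc : ContinuousOn S (Icc t₁ t₂) := (continuousOn_tsum_inv_deBruijnZero_sq hreal).mono hsub
  have hlim : ∀ t ∈ Icc t₁ t₂, Tendsto (F · t) atTop (𝓝 (S t)) := fun t ht ↦
    (summable_inv_deBruijnZero_sq (hΛ t ht)).hasSum.tendsto_sum_nat
  have hU := Monotone.tendstoUniformlyOn_of_forall_tendsto isCompact_Icc hFc hmono hSc hlim
  rw [Metric.tendstoUniformlyOn_iff] at hU
  obtain ⟨N, hN⟩ := eventually_atTop.1 (hU ε hε)
  refine ⟨N, fun n hn t ht ↦ ?_⟩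
  have h := hN n hn t ht
  rw [Real.dist_eq] at h
  have htail : S t - F n t = ∑' j : ℕ, 1 / deBruijnZero t (j + n + 1) ^ 2 := by
    simp only [hS, hF]
    rw [← Summable.sum_add_tsum_nat_add n (summable_inv_deBruijnZero_sq (hΛ t ht))]
    simp only [add_sub_cancel_left]
  rw [← htail]
  exact lt_of_le_of_lt (le_abs_self _) h

/-! ### Summability over `ℤ* ∖ K`, window sums, positivity of the coupling -/

/-- Far zeros interact weakly, energy version: if `|a| ≤ M`, `2M ≤ |x|`, `x ≠ 0`, then
`1/(x − a)² ≤ 4/x²`. [folklore] -/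
private theorem inv_sub_sq_le {x a M : ℝ} (ha : |a| ≤ M) (hx : 2 * M ≤ |x|) (hx0 : x ≠ 0) :
    1 / (x - a) ^ 2 ≤ 4 / x ^ 2 := by
  have h := abs_crossTerm_le ha ha hx hx0
  rwa [← pow_two, abs_of_nonneg (by positivity)] at h

/-- Fourth-power version: if `|a| ≤ M`, `2M ≤ |x|` and `1 ≤ |x|`, then `8/(x − a)⁴ ≤ 128/x²`.
[folklore] -/
private theorem div_sub_pow_four_le {x a M : ℝ} (ha : |a| ≤ M) (hx : 2 * M ≤ |x|) (hx1 : 1 ≤ |x|) :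
    8 / (x - a) ^ 4 ≤ 128 / x ^ 2 := by
  have hx0 : x ≠ 0 := fun h ↦ by rw [h, abs_zero] at hx1; exact absurd hx1 (by norm_num)
  have h := inv_sub_sq_le ha hx hx0
  have hx2 : 1 ≤ x ^ 2 := (one_le_sq_iff_one_le_abs x).2 hx1
  have hxx : 1 / x ^ 2 ≤ 1 := (div_le_one (by positivity)).2 hx2
  have hxa : (x - a) ^ 4 = ((x - a) ^ 2) ^ 2 := by ring
  calc 8 / (x - a) ^ 4 = 8 * (1 / (x - a) ^ 2) ^ 2 := by rw [hxa, one_div_pow]; ring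
    _ ≤ 8 * (4 / x ^ 2) ^ 2 := by gcongr
    _ = 128 / x ^ 2 * (1 / x ^ 2) := by ring
    _ ≤ 128 / x ^ 2 * 1 := by gcongr
    _ = 128 / x ^ 2 := mul_one _

/-- **Absolute convergence of the cross energies**: for `t > Λ` and any `k`, the energies
`j ↦ E_{jk}(t) = 1/(x_j − x_k)²` are summable over `j ∈ ℤ` (comparison with `4/x_j²`; source:
"thanks to (50), (43)", here from `Σ 1/x_j² < ∞`). [cite: RodgersTaoFMP2020, Lemma 12 (ii) p. 31] -/
theorem summable_interactionEnergy_int {t : ℝ}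
    (hΛ : ∃ t₁ : ℝ, t₁ < t ∧ HasOnlyRealZeros (deBruijnH t₁)) (k : ℤ) :
    Summable fun j : ℤ ↦ interactionEnergy t j k := by
  set M : ℝ := |deBruijnZeroZ t k| with hM
  have hg : Summable fun n : ℕ ↦ 4 / deBruijnZero t n ^ 2 := by
    have h1 : Summable fun n : ℕ ↦ 1 / deBruijnZero t n ^ 2 :=
      (summable_nat_add_iff 1).1 (summable_inv_deBruijnZero_sq hΛ)
    refine (h1.mul_left 4).congr fun n ↦ ?_
    ring
  have hev : ∀ᶠ n : ℕ in atTop, 2 * M ≤ deBruijnZero t n ∧ 0 < deBruijnZero t n := by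
    filter_upwards [(tendsto_deBruijnZero_atTop hΛ).eventually (eventually_ge_atTop (2 * M)),
      (tendsto_deBruijnZero_atTop hΛ).eventually (eventually_gt_atTop 0)] with n h1 h2
    exact ⟨h1, h2⟩
  rw [summable_int_iff_summable_nat_and_neg]
  constructor
  · refine Summable.of_norm_bounded_eventually hg ?_
    rw [Nat.cofinite_eq_atTop]
    filter_upwards [hev] with n ⟨hn, hn0⟩
    rw [Real.norm_eq_abs, interactionEnergy_eq, deBruijnZeroZ_natCast,
      abs_of_nonneg (by positivity)]
    exact inv_sub_sq_le le_rfl (by rwa [abs_of_pos hn0]) hn0.ne'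
  · refine Summable.of_norm_bounded_eventually hg ?_
    rw [Nat.cofinite_eq_atTop]
    filter_upwards [hev] with n ⟨hn, hn0⟩
    rw [Real.norm_eq_abs, interactionEnergy_eq, deBruijnZeroZ_neg_natCast,
      abs_of_nonneg (by positivity)]
    have h := inv_sub_sq_le (le_refl M) (x := -deBruijnZero t n)
      (by rwa [abs_neg, abs_of_pos hn0]) (neg_ne_zero.2 hn0.ne')
    rwa [neg_sq] at h

/-- **Absolute convergence of the error terms of (ii)**: for `t > Λ` and any `k`,
`j ↦ 8/(x_k − x_j)⁴` is summable over `j ∈ ℤ`. [cite: RodgersTaoFMP2020, Lemma 12 (ii) p. 31] -/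
theorem summable_div_sub_pow_four_int {t : ℝ}
    (hΛ : ∃ t₁ : ℝ, t₁ < t ∧ HasOnlyRealZeros (deBruijnH t₁)) (k : ℤ) :
    Summable fun j : ℤ ↦ 8 / (deBruijnZeroZ t k - deBruijnZeroZ t j) ^ 4 := by
  set M : ℝ := |deBruijnZeroZ t k| with hM
  have hg : Summable fun n : ℕ ↦ 128 / deBruijnZero t n ^ 2 := by
    have h1 : Summable fun n : ℕ ↦ 1 / deBruijnZero t n ^ 2 :=
      (summable_nat_add_iff 1).1 (summable_inv_deBruijnZero_sq hΛ)
    refine (h1.mul_left 128).congr fun n ↦ ?_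
    ring
  have hev : ∀ᶠ n : ℕ in atTop, 2 * M ≤ deBruijnZero t n ∧ 1 ≤ deBruijnZero t n := by
    filter_upwards [(tendsto_deBruijnZero_atTop hΛ).eventually (eventually_ge_atTop (2 * M)),
      (tendsto_deBruijnZero_atTop hΛ).eventually (eventually_ge_atTop 1)] with n h1 h2
    exact ⟨h1, h2⟩
  have hflip : ∀ j : ℤ, 8 / (deBruijnZeroZ t k - deBruijnZeroZ t j) ^ 4 =
      8 / (deBruijnZeroZ t j - deBruijnZeroZ t k) ^ 4 := fun j ↦ by ring
  simp_rw [hflip]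
  rw [summable_int_iff_summable_nat_and_neg]
  constructor
  · refine Summable.of_norm_bounded_eventually hg ?_
    rw [Nat.cofinite_eq_atTop]
    filter_upwards [hev] with n ⟨hn, hn1⟩
    have hn0 : 0 < deBruijnZero t n := lt_of_lt_of_le one_pos hn1
    rw [Real.norm_eq_abs, deBruijnZeroZ_natCast, abs_of_nonneg (by positivity)]
    exact div_sub_pow_four_le le_rfl (by rwa [abs_of_pos hn0]) (by rwa [abs_of_pos hn0])
  · refine Summable.of_norm_bounded_eventually hg ?_
    rw [Nat.cofinite_eq_atTop]
    filter_upwards [hev] with n ⟨hn, hn1⟩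
    have hn0 : 0 < deBruijnZero t n := lt_of_lt_of_le one_pos hn1
    rw [Real.norm_eq_abs, deBruijnZeroZ_neg_natCast, abs_of_nonneg (by positivity)]
    have h := div_sub_pow_four_le (le_refl M) (x := -deBruijnZero t n)
      (by rwa [abs_neg, abs_of_pos hn0]) (by rwa [abs_neg, abs_of_pos hn0])
    rwa [neg_sq] at h

/-- **Window sums converge to the sum over `ℤ* ∖ K`**: for a summable `f : ℤ → ℝ`,
`Σ_{j ∈ [−R,R]_{ℤ*} ∖ K} f(j) → Σ_{j ∈ ℤ* ∖ K} f(j)` as `R → ∞` (the monotone/absolute convergence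
used on p. 31 of the source to pass from `K ∪ {j}` to the infinite sum).
[cite: RodgersTaoFMP2020, Lemma 12 (ii) p. 31] -/
theorem tendsto_sum_window_sdiff {f : ℤ → ℝ} (hf : Summable f) (K : Finset ℤ) :
    Tendsto (fun R : ℕ ↦ ∑ j ∈ zstarIcc (-(R : ℤ)) R \ K, f j) atTop
      (𝓝 (∑' j : zstarCompl K, f j)) := by
  classical
  set C : Set ℤ := zstarCompl K with hC
  have hsub : Summable (fun j : C ↦ f j) := hf.subtype _
  have hhas : HasSum (C.indicator f) (∑' j : C, f j) :=
    hasSum_subtype_iff_indicator.1 hsub.hasSum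
  have hwin : Tendsto (fun R : ℕ ↦ Finset.Icc (-(R : ℤ)) R) atTop atTop := by
    refine tendsto_atTop_finset_of_monotone (fun R R' h ↦ Finset.Icc_subset_Icc ?_ ?_) fun i ↦
      ⟨i.natAbs, Finset.mem_Icc.2 ⟨by omega, by omega⟩⟩
    · exact neg_le_neg (by exact_mod_cast h)
    · exact_mod_cast h
  have h := hhas.comp hwin
  refine h.congr fun R ↦ ?_
  simp only [Function.comp_apply]
  rw [← Finset.sum_filter_add_sum_filter_not (Finset.Icc (-(R : ℤ)) R) (· ∈ C)]
  have hzero : ∑ i ∈ (Finset.Icc (-(R : ℤ)) R).filter (· ∉ C), C.indicator f i = 0 :=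
    Finset.sum_eq_zero fun i hi ↦ Set.indicator_of_notMem (Finset.mem_filter.1 hi).2 _
  rw [hzero, add_zero]
  have hset : (Finset.Icc (-(R : ℤ)) R).filter (· ∈ C) = zstarIcc (-(R : ℤ)) R \ K := by
    ext i
    simp only [Finset.mem_filter, Finset.mem_Icc, hC, mem_zstarCompl, Finset.mem_sdiff,
      mem_zstarIcc]
    tauto
  rw [hset]
  exact Finset.sum_congr rfl fun i hi ↦ Set.indicator_of_mem (by
    have := hi
    rw [← hset, Finset.mem_filter] at this
    exact this.2) _

/-- Zeros outside a window see every pair inside it from one side: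
`1/((x_i − x_a)(x_i − x_b)) ≥ 0` when `i < a, b` or `i > a, b` (`t > Λ`). [folklore] -/
private theorem rodgersTaoCrossTerm_nonneg_of_far {t : ℝ}
    (hΛ : ∃ t₁ : ℝ, t₁ < t ∧ HasOnlyRealZeros (deBruijnH t₁)) {a b i : ℤ}
    (h : (i < a ∧ i < b) ∨ (a < i ∧ b < i)) : 0 ≤ rodgersTaoCrossTerm t a b i := by
  rw [rodgersTaoCrossTerm_eq]
  have hsm := strictMono_deBruijnZeroZ hΛ
  rcases h with ⟨hia, hib⟩ | ⟨hai, hbi⟩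
  · have h1 : deBruijnZeroZ t i - deBruijnZeroZ t a < 0 := sub_neg.2 (hsm hia)
    have h2 : deBruijnZeroZ t i - deBruijnZeroZ t b < 0 := sub_neg.2 (hsm hib)
    exact div_nonneg zero_le_one (mul_pos_of_neg_of_neg h1 h2).le
  · have h1 : 0 < deBruijnZeroZ t i - deBruijnZeroZ t a := sub_pos.2 (hsm hai)
    have h2 : 0 < deBruijnZeroZ t i - deBruijnZeroZ t b := sub_pos.2 (hsm hbi)
    positivity

/-- The environment outside a window `[−R, R]_{ℤ*}` couples nonnegatively to any pair inside it:
`Σ_{i ∈ ℤ* ∖ [−R,R]} 1/((x_i − x_a)(x_i − x_b)) ≥ 0` for `a, b ∈ [−R, R]_{ℤ*}` (`t > Λ`).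
[folklore] -/
private theorem rodgersTaoCrossSum_window_nonneg {t : ℝ}
    (hΛ : ∃ t₁ : ℝ, t₁ < t ∧ HasOnlyRealZeros (deBruijnH t₁)) (R : ℕ) {a b : ℤ}
    (ha : a ∈ zstarIcc (-(R : ℤ)) R) (hb : b ∈ zstarIcc (-(R : ℤ)) R) :
    0 ≤ rodgersTaoCrossSum t (zstarIcc (-(R : ℤ)) R) a b := by
  rw [rodgersTaoCrossSum_eq]
  refine tsum_nonneg fun i ↦ rodgersTaoCrossTerm_nonneg_of_far hΛ ?_
  have hi := i.2
  rw [mem_zstarCompl, mem_zstarIcc] at hi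
  rw [mem_zstarIcc] at ha hb
  omega

/-- A finite double sum whose summand has nonnegative symmetrisation is nonnegative. [folklore] -/
private theorem sum_sum_nonneg_of_symm (S : Finset ℤ) (φ : ℤ → ℤ → ℝ)
    (h : ∀ a ∈ S, ∀ b ∈ S, 0 ≤ φ a b + φ b a) : 0 ≤ ∑ a ∈ S, ∑ b ∈ S, φ a b := by
  have hcomm := Finset.sum_comm (s := S) (t := S) (f := fun a b ↦ φ b a)
  have hnn : 0 ≤ ∑ a ∈ S, ∑ b ∈ S, (φ a b + φ b a) :=
    Finset.sum_nonneg fun a ha ↦ Finset.sum_nonneg fun b hb ↦ h a ha b hb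
  simp only [Finset.sum_add_distrib] at hnn
  linarith

/-- The symmetrisation of the proof of Lemma 12 (ii), first kind (`j` fixed, symmetrise in
`k, i ∈ K`): `1/((c − a)(c − b))/(a − b)² + 1/((b − a)(b − c))/(a − c)² = 1/((a − b)²(a − c)²)`
(`a = x_j`, `b = x_k`, `c = x_i`; source p. 32: "we can symmetrize at the cost of a factor of 2 to
obtain `Σ 2/((x_k − x_j)²(x_{k'} − x_j)²)`"). [cite: RodgersTaoFMP2020, Lemma 12 (ii) p. 32] -/
private theorem symm_first {a b c : ℝ} (hab : a - b ≠ 0) (hac : a - c ≠ 0) (hbc : b - c ≠ 0) :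
    1 / ((c - a) * (c - b)) / (a - b) ^ 2 + 1 / ((b - a) * (b - c)) / (a - c) ^ 2 =
      1 / ((a - b) ^ 2 * (a - c) ^ 2) := by
  have hba : b - a ≠ 0 := fun h ↦ hab (by linarith)
  have hca : c - a ≠ 0 := fun h ↦ hac (by linarith)
  have hcb : c - b ≠ 0 := fun h ↦ hbc (by linarith)
  field_simp
  ring

/-- The symmetrisation of the proof of Lemma 12 (ii), second kind (`k` fixed, symmetrise in
`j, i ∉ K`): `1/((c − a)(c − b))/(a − b)² + 1/((a − c)(a − b))/(c − b)² = 1/((a − b)²(c − b)²)`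
(`a = x_j`, `b = x_k`, `c = x_i`; source p. 32: "`Σ 2/((x_k − x_j)²(x_k − x_i)²)`").
[cite: RodgersTaoFMP2020, Lemma 12 (ii) p. 32] -/
private theorem symm_second {a b c : ℝ} (hab : a - b ≠ 0) (hcb : c - b ≠ 0) (hac : a - c ≠ 0) :
    1 / ((c - a) * (c - b)) / (a - b) ^ 2 + 1 / ((a - c) * (a - b)) / (c - b) ^ 2 =
      1 / ((a - b) ^ 2 * (c - b) ^ 2) := by
  have hca : c - a ≠ 0 := fun h ↦ hac (by linarith)
  field_simp
  ring

/-- **Positivity of the coupling in (ii)** (source p. 32: the three sums displayed after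
"which we can expand as" are nonnegative — the two finite ones after symmetrisation, the one over
`i ∉ K ∪ {j}` outside the window by sign). For a window `W = [−R, R]_{ℤ*} ⊇ K`:
`Σ_{k ∈ K} Σ_{j ∈ W ∖ K} (x_j − x_k)⁻² Σ_{i ∈ ℤ* ∖ {j,k}} 1/((x_i − x_j)(x_i − x_k)) ≥ 0`.
[cite: RodgersTaoFMP2020, Lemma 12 (ii) p. 32] -/
theorem sum_window_rodgersTaoCrossSum_div_sq_nonneg {t : ℝ}
    (hΛ : ∃ t₁ : ℝ, t₁ < t ∧ HasOnlyRealZeros (deBruijnH t₁)) {K : Finset ℤ} {R : ℕ}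
    (hKW : K ⊆ zstarIcc (-(R : ℤ)) R) :
    0 ≤ ∑ k ∈ K, ∑ j ∈ zstarIcc (-(R : ℤ)) R \ K,
      rodgersTaoCrossSum t {j, k} j k / (deBruijnZeroZ t j - deBruijnZeroZ t k) ^ 2 := by
  classical
  set W := zstarIcc (-(R : ℤ)) R with hW
  have hW0 : (0 : ℤ) ∉ W := zero_notMem_zstarIcc _ _
  set x := deBruijnZeroZ t with hx
  set θ : ℤ → ℤ → ℤ → ℝ := fun j k i ↦ rodgersTaoCrossTerm t j k i / (x j - x k) ^ 2 with hθ
  have hθ_eq : ∀ j k i, θ j k i = 1 / ((x i - x j) * (x i - x k)) / (x j - x k) ^ 2 := by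
    intro j k i; simp only [hθ, rodgersTaoCrossTerm_eq, hx]
  -- splitting each pair's environment `ℤ* ∖ {j,k} = (K ∖ {k}) ⊔ ((W ∖ K) ∖ {j}) ⊔ (ℤ* ∖ W)`
  have hsplit : ∀ k ∈ K, ∀ j ∈ W \ K,
      rodgersTaoCrossSum t {j, k} j k / (x j - x k) ^ 2 =
        (∑ i ∈ K.erase k, θ j k i + ∑ i ∈ (W \ K).erase j, θ j k i) +
          rodgersTaoCrossSum t W j k / (x j - x k) ^ 2 := by
    intro k hk j hj
    have hjW : j ∈ W := (Finset.mem_sdiff.1 hj).1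
    have hjK : j ∉ K := (Finset.mem_sdiff.1 hj).2
    have hset : (W.erase j).erase k = K.erase k ∪ (W \ K).erase j := by
      ext i
      simp only [Finset.mem_erase, Finset.mem_union, Finset.mem_sdiff]
      constructor
      · rintro ⟨hik, hij, hiW⟩
        by_cases hiK : i ∈ K
        · exact Or.inl ⟨hik, hiK⟩
        · exact Or.inr ⟨hij, hiW, hiK⟩
      · rintro (⟨hik, hiK⟩ | ⟨hij, hiW, hiK⟩)
        · exact ⟨hik, fun h ↦ hjK (h ▸ hiK), hKW hiK⟩
        · exact ⟨fun h ↦ hiK (h ▸ hk), hij, hiW⟩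
    have hdisj : Disjoint (K.erase k) ((W \ K).erase j) := by
      rw [Finset.disjoint_left]
      intro i hi hi'
      exact (Finset.mem_sdiff.1 (Finset.mem_of_mem_erase hi')).2 (Finset.mem_of_mem_erase hi)
    rw [rodgersTaoCrossSum_pair_eq hΛ hW0 hjW (hKW hk), add_div, Finset.sum_div, hset,
      Finset.sum_union hdisj]
  rw [Finset.sum_congr rfl fun k hk ↦ Finset.sum_congr rfl fun j hj ↦ hsplit k hk j hj]
  simp only [Finset.sum_add_distrib]
  -- the three parts are separately nonnegative
  have hxsub : ∀ {a b : ℤ}, a ≠ b → x a - x b ≠ 0 := fun hab ↦ by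
    rw [hx]; exact deBruijnZeroZ_sub_ne_zero hΛ (Ne.symm hab)
  have hA : 0 ≤ ∑ k ∈ K, ∑ j ∈ W \ K, ∑ i ∈ K.erase k, θ j k i := by
    rw [Finset.sum_comm]
    refine Finset.sum_nonneg fun j hj ↦ ?_
    have hjK : j ∉ K := (Finset.mem_sdiff.1 hj).2
    have herase : ∀ k ∈ K, ∑ i ∈ K.erase k, θ j k i = ∑ i ∈ K, θ j k i := fun k _ ↦
      Finset.sum_erase (s := K) (f := fun i ↦ θ j k i) (a := k)
        (by rw [hθ_eq, sub_self, mul_zero, div_zero, zero_div])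
    rw [Finset.sum_congr rfl herase]
    refine sum_sum_nonneg_of_symm K (fun k i ↦ θ j k i) fun k hk i hi ↦ ?_
    have hjk : j ≠ k := fun h ↦ hjK (h ▸ hk)
    have hji : j ≠ i := fun h ↦ hjK (h ▸ hi)
    by_cases hki : k = i
    · subst hki
      rw [hθ_eq, sub_self, mul_zero, div_zero, zero_div, add_zero]
    · simp only [hθ_eq]
      rw [symm_first (hxsub hjk) (hxsub hji) (hxsub hki)]
      positivity
  have hB : 0 ≤ ∑ k ∈ K, ∑ j ∈ W \ K, ∑ i ∈ (W \ K).erase j, θ j k i := by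
    refine Finset.sum_nonneg fun k hk ↦ ?_
    have herase : ∀ j ∈ W \ K, ∑ i ∈ (W \ K).erase j, θ j k i = ∑ i ∈ W \ K, θ j k i :=
      fun j _ ↦ Finset.sum_erase (s := W \ K) (f := fun i ↦ θ j k i) (a := j)
        (by rw [hθ_eq, sub_self, zero_mul, div_zero, zero_div])
    rw [Finset.sum_congr rfl herase]
    refine sum_sum_nonneg_of_symm (W \ K) (fun j i ↦ θ j k i) fun j hj i hi ↦ ?_
    have hjk : j ≠ k := fun h ↦ (Finset.mem_sdiff.1 hj).2 (h ▸ hk)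
    have hik : i ≠ k := fun h ↦ (Finset.mem_sdiff.1 hi).2 (h ▸ hk)
    by_cases hji : j = i
    · subst hji
      rw [hθ_eq, sub_self, zero_mul, div_zero, zero_div, add_zero]
    · simp only [hθ_eq]
      rw [symm_second (hxsub hjk) (hxsub hik) (hxsub hji)]
      positivity
  have hC : 0 ≤ ∑ k ∈ K, ∑ j ∈ W \ K, rodgersTaoCrossSum t W j k / (x j - x k) ^ 2 :=
    Finset.sum_nonneg fun k hk ↦ Finset.sum_nonneg fun j hj ↦
      div_nonneg (rodgersTaoCrossSum_window_nonneg hΛ R (Finset.mem_sdiff.1 hj).1 (hKW hk))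
        (sq_nonneg _)
  linarith

/-! ### The weak inequality

Notation in this section: `K ⊂ ℤ*` finite, `W_R = [−R, R]_{ℤ*}` a window,
`g_k(t, j) = 8/(x_k − x_j)⁴` (the integrand term of (ii)), truncated sums `Σ_{j ∈ W_R ∖ K}` and
their limits `Σ_{j ∈ ℤ* ∖ K}`. -/

/-- Window sums of a nonnegative summable function are below the full sum over `ℤ* ∖ K`.
[folklore] -/
private theorem sum_window_sdiff_le_tsum {f : ℤ → ℝ} (hf : Summable f) (hnn : ∀ j, 0 ≤ f j)
    (K : Finset ℤ) (R : ℕ) :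
    ∑ j ∈ zstarIcc (-(R : ℤ)) R \ K, f j ≤ ∑' j : zstarCompl K, f j := by
  refine ge_of_tendsto (tendsto_sum_window_sdiff hf K) ?_
  filter_upwards [eventually_ge_atTop R] with R' hR'
  refine Finset.sum_le_sum_of_subset_of_nonneg (Finset.sdiff_subset_sdiff ?_ le_rfl)
    fun j _ _ ↦ hnn j
  intro j hj
  rw [mem_zstarIcc] at hj ⊢
  omega

/-- Symmetric decomposition of a sum over an annulus `W_{R'} ∖ W_R` (`R ≤ R'`):
`Σ_{j ∈ W_{R'} ∖ W_R} g(j) = Σ_{R ≤ m < R'} (g(m+1) + g(−(m+1)))`. [folklore] -/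
private theorem sum_zstarIcc_sdiff_symm (g : ℤ → ℝ) {R R' : ℕ} (h : R ≤ R') :
    ∑ j ∈ zstarIcc (-(R' : ℤ)) R' \ zstarIcc (-(R : ℤ)) R, g j =
      ∑ m ∈ Finset.Ico R R', (g ((m : ℤ) + 1) + g (-((m : ℤ) + 1))) := by
  have hsub : zstarIcc (-(R : ℤ)) R ⊆ zstarIcc (-(R' : ℤ)) R' := by
    intro j hj
    rw [mem_zstarIcc] at hj ⊢
    omega
  rw [Finset.sum_sdiff_eq_sub hsub, sum_zstarIcc_symm, sum_zstarIcc_symm,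
    Finset.sum_Ico_eq_sub _ h]

/-- **Uniform bound on the tracked zeros**: on a compact time interval in `(Λ, ∞)`, the finitely
many zeros `x_k(t)`, `k ∈ K`, stay in a bounded set. [folklore] -/
private theorem exists_bound_deBruijnZeroZ {t₀ t₁ t₂ : ℝ} (hreal : HasOnlyRealZeros (deBruijnH t₀))
    (h01 : t₀ < t₁) (K : Finset ℤ) :
    ∃ M : ℝ, 0 ≤ M ∧ ∀ t ∈ Icc t₁ t₂, ∀ k ∈ K, |deBruijnZeroZ t k| ≤ M := by
  have hΛ : ∀ t ∈ Icc t₁ t₂, ∃ t' : ℝ, t' < t ∧ HasOnlyRealZeros (deBruijnH t') := fun t ht ↦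
    ⟨t₀, lt_of_lt_of_le h01 ht.1, hreal⟩
  set f : ℝ → ℝ := fun t ↦ ∑ k ∈ K, |deBruijnZeroZ t k| with hf
  have hfc : ContinuousOn f (Icc t₁ t₂) := by
    refine continuousOn_finsetSum _ fun k _ t ht ↦ ?_
    exact ((continuousAt_deBruijnZeroZ (hΛ t ht) k).abs).continuousWithinAt
  obtain ⟨M, hM⟩ := isCompact_Icc.bddAbove_image hfc
  refine ⟨max M 0, le_max_right _ _, fun t ht k hk ↦ ?_⟩
  have h1 : |deBruijnZeroZ t k| ≤ f t :=
    Finset.single_le_sum (f := fun k ↦ |deBruijnZeroZ t k|) (fun i _ ↦ abs_nonneg _) hk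
  exact h1.trans ((hM ⟨t, ht, rfl⟩).trans (le_max_left _ _))

/-- **Uniform escape of the far zeros**: on a compact time interval in `(Λ, ∞)`, given `L`, all
zeros `x_{n+1}(t)` with `n ≥ N` exceed `L`, uniformly in `t` (from the uniform tails of
`Σ 1/x_j(t)²`). [cite: RodgersTaoFMP2020, Lemma 12 (ii) p. 31] -/
private theorem exists_uniform_deBruijnZero_gt {t₀ t₁ t₂ : ℝ}
    (hreal : HasOnlyRealZeros (deBruijnH t₀)) (h01 : t₀ < t₁) (L : ℝ) :
    ∃ N : ℕ, ∀ n, N ≤ n → ∀ t ∈ Icc t₁ t₂, L < deBruijnZero t (n + 1) := by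
  have hΛ : ∀ t ∈ Icc t₁ t₂, ∃ t' : ℝ, t' < t ∧ HasOnlyRealZeros (deBruijnH t') := fun t ht ↦
    ⟨t₀, lt_of_lt_of_le h01 ht.1, hreal⟩
  rcases le_or_gt L 0 with hL | hL
  · exact ⟨0, fun n _ t ht ↦ lt_of_le_of_lt hL (deBruijnZero_pos (hΛ t ht) (by omega))⟩
  obtain ⟨N, hN⟩ := uniform_tail_inv_deBruijnZero_sq (t₂ := t₂) hreal h01
    (show (0 : ℝ) < 1 / L ^ 2 by positivity)
  refine ⟨N, fun n hn t ht ↦ ?_⟩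
  have hs : Summable fun j : ℕ ↦ 1 / deBruijnZero t (j + n + 1) ^ 2 :=
    (summable_nat_add_iff n).2 (summable_inv_deBruijnZero_sq (hΛ t ht))
  have hx : 0 < deBruijnZero t (n + 1) := deBruijnZero_pos (hΛ t ht) (by omega)
  have h1 : 1 / deBruijnZero t (n + 1) ^ 2 ≤ ∑' j : ℕ, 1 / deBruijnZero t (j + n + 1) ^ 2 := by
    have := hs.le_tsum 0 fun j _ ↦ by positivity
    simpa only [zero_add] using this
  have h2 : 1 / deBruijnZero t (n + 1) ^ 2 < 1 / L ^ 2 := lt_of_le_of_lt h1 (hN n hn t ht)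
  rw [one_div_lt_one_div (pow_pos hx 2) (pow_pos hL 2)] at h2
  exact lt_of_pow_lt_pow_left₀ 2 hx.le h2

/-- **Uniform tails of the window sums of `g_k(t, ·) = 8/(x_k − x_j)⁴`** on a compact time
interval: for `R' ≥ R ≥ N`, `0 ≤ Σ_{j ∈ W_{R'} ∖ K} g_k(t,j) − Σ_{j ∈ W_R ∖ K} g_k(t,j) ≤ ε`
uniformly in `t ∈ [t₁, t₂]` and `k ∈ K` (source p. 31: the monotone convergence step).
[cite: RodgersTaoFMP2020, Lemma 12 (ii) p. 31] -/
private theorem uniform_window_tail {t₀ t₁ t₂ : ℝ} (hreal : HasOnlyRealZeros (deBruijnH t₀))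
    (h01 : t₀ < t₁) (K : Finset ℤ) {ε : ℝ} (hε : 0 < ε) :
    ∃ N : ℕ, ∀ R, N ≤ R → ∀ R', R ≤ R' → ∀ t ∈ Icc t₁ t₂, ∀ k ∈ K,
      0 ≤ ∑ j ∈ zstarIcc (-(R' : ℤ)) R' \ K, 8 / (deBruijnZeroZ t k - deBruijnZeroZ t j) ^ 4 -
          ∑ j ∈ zstarIcc (-(R : ℤ)) R \ K, 8 / (deBruijnZeroZ t k - deBruijnZeroZ t j) ^ 4 ∧
      ∑ j ∈ zstarIcc (-(R' : ℤ)) R' \ K, 8 / (deBruijnZeroZ t k - deBruijnZeroZ t j) ^ 4 -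
          ∑ j ∈ zstarIcc (-(R : ℤ)) R \ K, 8 / (deBruijnZeroZ t k - deBruijnZeroZ t j) ^ 4 ≤ ε := by
  have hΛ : ∀ t ∈ Icc t₁ t₂, ∃ t' : ℝ, t' < t ∧ HasOnlyRealZeros (deBruijnH t') := fun t ht ↦
    ⟨t₀, lt_of_lt_of_le h01 ht.1, hreal⟩
  obtain ⟨M, hM0, hM⟩ := exists_bound_deBruijnZeroZ (t₂ := t₂) hreal h01 K
  obtain ⟨N₁, hN₁⟩ := exists_uniform_deBruijnZero_gt (t₂ := t₂) hreal h01 (max (2 * M) 1)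
  obtain ⟨N₂, hN₂⟩ := uniform_tail_inv_deBruijnZero_sq (t₂ := t₂) hreal h01
    (show (0 : ℝ) < ε / 256 by positivity)
  refine ⟨max N₁ N₂, fun R hR R' hRR' t ht k hk ↦ ?_⟩
  set W : ℕ → Finset ℤ := fun R ↦ zstarIcc (-(R : ℤ)) R with hW
  set g : ℤ → ℝ := fun j ↦ 8 / (deBruijnZeroZ t k - deBruijnZeroZ t j) ^ 4 with hg
  have hgnn : ∀ j, 0 ≤ g j := fun j ↦ by positivity
  have hWsub : W R ⊆ W R' := by
    intro j hj
    simp only [hW, mem_zstarIcc] at hj ⊢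
    omega
  have hsub : W R \ K ⊆ W R' \ K := Finset.sdiff_subset_sdiff hWsub le_rfl
  have hdiff : ∑ j ∈ W R' \ K, g j - ∑ j ∈ W R \ K, g j = ∑ j ∈ (W R' \ K) \ (W R \ K), g j :=
    (Finset.sum_sdiff_eq_sub hsub).symm
  refine ⟨by rw [hdiff]; exact Finset.sum_nonneg fun j _ ↦ hgnn j, ?_⟩
  rw [hdiff]
  -- the annulus `W_{R'} ∖ W_R` carries the difference
  have hann : (W R' \ K) \ (W R \ K) ⊆ W R' \ W R := by
    intro j hj
    simp only [Finset.mem_sdiff, not_and, not_not] at hj ⊢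
    exact ⟨hj.1.1, fun h ↦ hj.1.2 (hj.2 h)⟩
  -- termwise bound on the annulus: `g(j) ≤ 128/x_j²`
  have hfar : ∀ j ∈ W R' \ W R, g j ≤ 128 / deBruijnZeroZ t j ^ 2 := by
    intro j hj
    simp only [hW, Finset.mem_sdiff, mem_zstarIcc] at hj
    obtain ⟨m, hm⟩ : ∃ m : ℕ, j.natAbs = m + 1 := ⟨j.natAbs - 1, by omega⟩
    have hmN : N₁ ≤ m := by omega
    have hbig := hN₁ m hmN t ht
    have habs : |deBruijnZeroZ t j| = deBruijnZero t (m + 1) := by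
      rcases le_or_gt 0 j with hj0 | hj0
      · have : j = ((m + 1 : ℕ) : ℤ) := by omega
        rw [this, deBruijnZeroZ_natCast, abs_of_pos (lt_of_le_of_lt (by positivity) hbig)]
      · have : j = -((m + 1 : ℕ) : ℤ) := by omega
        rw [this, deBruijnZeroZ_neg_natCast, abs_neg,
          abs_of_pos (lt_of_le_of_lt (by positivity) hbig)]
    have h2M : 2 * M ≤ |deBruijnZeroZ t j| := by
      rw [habs]; exact ((le_max_left _ _).trans hbig.le)
    have h1 : 1 ≤ |deBruijnZeroZ t j| := by
      rw [habs]; exact ((le_max_right _ _).trans hbig.le)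
    have h := div_sub_pow_four_le (hM t ht k hk) h2M h1
    have hflip : g j = 8 / (deBruijnZeroZ t j - deBruijnZeroZ t k) ^ 4 := by
      simp only [hg]; ring
    rwa [hflip]
  -- summing the bound over the annulus
  have hRR : Summable fun j : ℕ ↦ 1 / deBruijnZero t (j + R + 1) ^ 2 :=
    (summable_nat_add_iff R).2 (summable_inv_deBruijnZero_sq (hΛ t ht))
  calc ∑ j ∈ (W R' \ K) \ (W R \ K), g j
      ≤ ∑ j ∈ W R' \ W R, g j := Finset.sum_le_sum_of_subset_of_nonneg hann fun j _ _ ↦ hgnn j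
    _ ≤ ∑ j ∈ W R' \ W R, 128 / deBruijnZeroZ t j ^ 2 := Finset.sum_le_sum hfar
    _ = ∑ m ∈ Finset.Ico R R', 256 / deBruijnZero t (m + 1) ^ 2 := by
        rw [hW, sum_zstarIcc_sdiff_symm _ hRR']
        refine Finset.sum_congr rfl fun m _ ↦ ?_
        have e1 : ((m : ℤ) + 1) = ((m + 1 : ℕ) : ℤ) := by push_cast; ring
        rw [e1, deBruijnZeroZ_natCast, deBruijnZeroZ_neg_natCast, neg_sq]
        ring
    _ = ∑ i ∈ Finset.range (R' - R), 256 * (1 / deBruijnZero t (i + R + 1) ^ 2) := by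
        rw [Finset.sum_Ico_eq_sum_range]
        refine Finset.sum_congr rfl fun i _ ↦ ?_
        rw [show R + i + 1 = i + R + 1 by ring]
        ring
    _ = 256 * ∑ i ∈ Finset.range (R' - R), 1 / deBruijnZero t (i + R + 1) ^ 2 := by
        rw [Finset.mul_sum]
    _ ≤ 256 * ∑' i : ℕ, 1 / deBruijnZero t (i + R + 1) ^ 2 := by
        gcongr
        exact hRR.sum_le_tsum _ fun i _ ↦ by positivity
    _ ≤ 256 * (ε / 256) := by
        gcongr
        exact (hN₂ R (le_of_max_le_right hR) t ht).le
    _ = ε := by ring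

/-- **The integrand of (ii) is continuous in time**: `t ↦ Σ_{k ∈ K} Σ_{j ∈ ℤ* ∖ K} 8/(x_k − x_j)⁴`
is continuous on every compact `[t₁, t₂] ⊂ (Λ, ∞)` (uniform limit of the window sums), hence
integrable there. [cite: RodgersTaoFMP2020, Lemma 12 (ii) p. 31] -/
theorem continuousOn_sum_tsum_div_sub_pow_four {t₀ t₁ t₂ : ℝ}
    (hreal : HasOnlyRealZeros (deBruijnH t₀)) (h01 : t₀ < t₁) (K : Finset ℤ) :
    ContinuousOn (fun t ↦ ∑ k ∈ K, ∑' j : zstarCompl K,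
      8 / (deBruijnZeroZ t k - deBruijnZeroZ t j) ^ 4) (Icc t₁ t₂) := by
  have hΛ : ∀ t ∈ Icc t₁ t₂, ∃ t' : ℝ, t' < t ∧ HasOnlyRealZeros (deBruijnH t') := fun t ht ↦
    ⟨t₀, lt_of_lt_of_le h01 ht.1, hreal⟩
  set Φ : ℝ → ℝ := fun t ↦ ∑ k ∈ K, ∑' j : zstarCompl K,
    8 / (deBruijnZeroZ t k - deBruijnZeroZ t j) ^ 4 with hΦ
  set h : ℕ → ℝ → ℝ := fun R t ↦ ∑ k ∈ K, ∑ j ∈ zstarIcc (-(R : ℤ)) R \ K,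
    8 / (deBruijnZeroZ t k - deBruijnZeroZ t j) ^ 4 with hh
  -- the window sums are continuous
  have hhc : ∀ R, ContinuousOn (h R) (Icc t₁ t₂) := by
    intro R
    refine continuousOn_finsetSum _ fun k hk ↦ continuousOn_finsetSum _ fun j hj t ht ↦ ?_
    have hjk : j ≠ k := fun e ↦ (Finset.mem_sdiff.1 hj).2 (e ▸ hk)
    have hne : (deBruijnZeroZ t k - deBruijnZeroZ t j) ^ 4 ≠ 0 :=
      pow_ne_zero 4 (deBruijnZeroZ_sub_ne_zero (hΛ t ht) hjk)
    have h1 : ContinuousAt (fun s ↦ (deBruijnZeroZ s k - deBruijnZeroZ s j) ^ 4) t := by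
      exact ((continuousAt_deBruijnZeroZ (hΛ t ht) k).sub
        (continuousAt_deBruijnZeroZ (hΛ t ht) j)).pow 4
    exact (continuousAt_const.div h1 hne).continuousWithinAt
  -- and converge uniformly to `Φ`
  have hU : TendstoUniformlyOn h Φ atTop (Icc t₁ t₂) := by
    rw [Metric.tendstoUniformlyOn_iff]
    intro ε hε
    obtain ⟨N, hN⟩ := uniform_window_tail (t₂ := t₂) hreal h01 K
      (show 0 < ε / (2 * ((K.card : ℝ) + 1)) by positivity)
    filter_upwards [eventually_ge_atTop N] with R hR t ht
    have hk : ∀ k ∈ K, 0 ≤ (∑' j : zstarCompl K, 8 / (deBruijnZeroZ t k - deBruijnZeroZ t j) ^ 4) -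
        ∑ j ∈ zstarIcc (-(R : ℤ)) R \ K, 8 / (deBruijnZeroZ t k - deBruijnZeroZ t j) ^ 4 ∧
        (∑' j : zstarCompl K, 8 / (deBruijnZeroZ t k - deBruijnZeroZ t j) ^ 4) -
        ∑ j ∈ zstarIcc (-(R : ℤ)) R \ K, 8 / (deBruijnZeroZ t k - deBruijnZeroZ t j) ^ 4 ≤
          ε / (2 * ((K.card : ℝ) + 1)) := by
      intro k hk
      have hlim := (tendsto_sum_window_sdiff (summable_div_sub_pow_four_int (hΛ t ht) k)
        K).sub_const
        (∑ j ∈ zstarIcc (-(R : ℤ)) R \ K, 8 / (deBruijnZeroZ t k - deBruijnZeroZ t j) ^ 4)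
      constructor
      · refine ge_of_tendsto hlim ?_
        filter_upwards [eventually_ge_atTop R] with R' hR'
        exact (hN R hR R' hR' t ht k hk).1
      · refine le_of_tendsto hlim ?_
        filter_upwards [eventually_ge_atTop R] with R' hR'
        exact (hN R hR R' hR' t ht k hk).2
    have hdiff : Φ t - h R t = ∑ k ∈ K,
        ((∑' j : zstarCompl K, 8 / (deBruijnZeroZ t k - deBruijnZeroZ t j) ^ 4) -
          ∑ j ∈ zstarIcc (-(R : ℤ)) R \ K, 8 / (deBruijnZeroZ t k - deBruijnZeroZ t j) ^ 4) := by
      simp only [hΦ, hh, Finset.sum_sub_distrib]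
    have h0 : 0 ≤ Φ t - h R t := by
      rw [hdiff]; exact Finset.sum_nonneg fun k hk' ↦ (hk k hk').1
    have h1 : Φ t - h R t ≤ K.card * (ε / (2 * ((K.card : ℝ) + 1))) := by
      rw [hdiff]
      calc _ ≤ ∑ k ∈ K, ε / (2 * ((K.card : ℝ) + 1)) := Finset.sum_le_sum fun k hk' ↦ (hk k hk').2
        _ = _ := by rw [Finset.sum_const, nsmul_eq_mul]
    have h2 : (K.card : ℝ) * (ε / (2 * ((K.card : ℝ) + 1))) < ε := by
      have hc : (0 : ℝ) ≤ K.card := Nat.cast_nonneg _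
      rw [← sub_pos]
      have e : ε - K.card * (ε / (2 * ((K.card : ℝ) + 1))) =
          ε * ((K.card : ℝ) + 2) / (2 * ((K.card : ℝ) + 1)) := by
        field_simp
        ring
      rw [e]
      positivity
    rw [Real.dist_eq, abs_of_nonneg h0]
    linarith
  exact hU.continuousOn (Eventually.of_forall hhc).frequently

/-- **The truncated cross-energy inequality** (source p. 31, applied with the finite set
`W_R ∖ K` of outside indices): for a window `W_R ⊇ K`,
`Σ_{k ∈ K, j ∈ W_R ∖ K} (E_{jk}(t₂) − E_{jk}(t₁)) ≥ −∫_{t₁}^{t₂} Σ_{k ∈ K, j ∉ K} 8/(x_k − x_j)⁴`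
— the fundamental theorem of calculus in inequality form for the differentiable finite sum, whose
derivative is `≥ −Σ 8/(x_k − x_j)⁴` by (i) and the positivity of the coupling
(`sum_window_rodgersTaoCrossSum_div_sq_nonneg`). [cite: RodgersTaoFMP2020, Lemma 12 (ii) p. 31] -/
theorem window_cross_energy_inequality {t₀ t₁ t₂ : ℝ} (hreal : HasOnlyRealZeros (deBruijnH t₀))
    (h01 : t₀ < t₁) (h12 : t₁ ≤ t₂) {K : Finset ℤ} (hK : (0 : ℤ) ∉ K) {R : ℕ}
    (hKW : K ⊆ zstarIcc (-(R : ℤ)) R) :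
    -(∫ t in t₁..t₂, ∑ k ∈ K, ∑' j : zstarCompl K,
        8 / (deBruijnZeroZ t k - deBruijnZeroZ t j) ^ 4) ≤
      ∑ k ∈ K, ∑ j ∈ zstarIcc (-(R : ℤ)) R \ K,
        (interactionEnergy t₂ j k - interactionEnergy t₁ j k) := by
  have hΛ : ∀ t ∈ Icc t₁ t₂, ∃ t' : ℝ, t' < t ∧ HasOnlyRealZeros (deBruijnH t') := fun t ht ↦
    ⟨t₀, lt_of_lt_of_le h01 ht.1, hreal⟩
  set W := zstarIcc (-(R : ℤ)) R with hW
  set F : ℝ → ℝ := fun s ↦ ∑ k ∈ K, ∑ j ∈ W \ K, interactionEnergy s j k with hF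
  set F' : ℝ → ℝ := fun s ↦ ∑ k ∈ K, ∑ j ∈ W \ K,
    (-8 / (deBruijnZeroZ s j - deBruijnZeroZ s k) ^ 4 +
      4 * rodgersTaoCrossSum s {j, k} j k / (deBruijnZeroZ s j - deBruijnZeroZ s k) ^ 2) with hF'
  set Φ : ℝ → ℝ := fun t ↦ ∑ k ∈ K, ∑' j : zstarCompl K,
    8 / (deBruijnZeroZ t k - deBruijnZeroZ t j) ^ 4 with hΦ
  have hjk : ∀ k ∈ K, ∀ j ∈ W \ K, j ≠ 0 ∧ k ≠ 0 ∧ j ≠ k := by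
    intro k hk j hj
    refine ⟨(mem_zstarIcc.1 (Finset.mem_sdiff.1 hj).1).1, fun h ↦ hK (h ▸ hk),
      fun h ↦ (Finset.mem_sdiff.1 hj).2 (h ▸ hk)⟩
  have hderiv : ∀ s ∈ Icc t₁ t₂, HasDerivAt F (F' s) s := by
    intro s hs
    simp only [hF, hF']
    refine HasDerivAt.fun_sum fun k hk ↦ HasDerivAt.fun_sum fun j hj ↦ ?_
    obtain ⟨hj0, hk0, hjk'⟩ := hjk k hk j hj
    exact hasDerivAt_interactionEnergy (hΛ s hs) hj0 hk0 hjk'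
  have hFc : ContinuousOn F (Icc t₁ t₂) := fun s hs ↦
    (hderiv s hs).continuousAt.continuousWithinAt
  have hΦc : ContinuousOn Φ (Icc t₁ t₂) := continuousOn_sum_tsum_div_sub_pow_four hreal h01 K
  -- the derivative dominates `−Φ`
  have hdom : ∀ s ∈ Ioo t₁ t₂, -Φ s ≤ F' s := by
    intro s hs
    have hs' : s ∈ Icc t₁ t₂ := Ioo_subset_Icc_self hs
    have hpos := sum_window_rodgersTaoCrossSum_div_sq_nonneg (hΛ s hs') hKW
    have hsplit : F' s = -(∑ k ∈ K, ∑ j ∈ W \ K, 8 / (deBruijnZeroZ s k - deBruijnZeroZ s j) ^ 4) +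
        4 * ∑ k ∈ K, ∑ j ∈ W \ K,
          rodgersTaoCrossSum s {j, k} j k / (deBruijnZeroZ s j - deBruijnZeroZ s k) ^ 2 := by
      simp only [hF']
      rw [Finset.mul_sum, ← Finset.sum_neg_distrib, ← Finset.sum_add_distrib]
      refine Finset.sum_congr rfl fun k _ ↦ ?_
      rw [Finset.mul_sum, ← Finset.sum_neg_distrib, ← Finset.sum_add_distrib]
      refine Finset.sum_congr rfl fun j _ ↦ ?_
      ring
    have hle : ∑ k ∈ K, ∑ j ∈ W \ K, 8 / (deBruijnZeroZ s k - deBruijnZeroZ s j) ^ 4 ≤ Φ s := by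
      simp only [hΦ]
      exact Finset.sum_le_sum fun k _ ↦ sum_window_sdiff_le_tsum
        (summable_div_sub_pow_four_int (hΛ s hs') k) (fun j ↦ by positivity) K R
    rw [hsplit]
    linarith
  have hint := intervalIntegral.integral_le_sub_of_hasDeriv_right_of_le h12 hFc
    (fun s hs ↦ (hderiv s (Ioo_subset_Icc_self hs)).hasDerivWithinAt)
    (hΦc.neg.integrableOn_Icc) hdom
  change ∫ y in t₁..t₂, -Φ y ≤ F t₂ - F t₁ at hint
  rw [intervalIntegral.integral_neg] at hint
  have hFsub : F t₂ - F t₁ = ∑ k ∈ K, ∑ j ∈ W \ K,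
      (interactionEnergy t₂ j k - interactionEnergy t₁ j k) := by
    simp only [hF, Finset.sum_sub_distrib]
  rw [← hFsub]
  exact hint

/-- **Rodgers–Tao 2020, Lemma 12 (ii) (= Lemma 4.2 (ii)), discharged**: the cross-energy
inequality in its printed weak form, for every finite `K ⊂ ℤ*` and `Λ < t₁ < t₂`:
`Σ_{k ∈ K, j ∉ K} (E_{jk}(t₂) − E_{jk}(t₁)) ≥ −∫_{t₁}^{t₂} Σ_{k ∈ K, j ∉ K} 8/(x_k − x_j)⁴ dt`,
all sums
absolutely convergent and the integrand continuous (hence integrable) on `[t₁, t₂]`. CONTENT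
discharge following the printed proof (pp. 31–32): for a finite set of outside indices (here a
window `W_R ∖ K`) the sum is differentiable with derivative given by (i); the coupling terms are
nonnegative after symmetrisation (`sum_window_rodgersTaoCrossSum_div_sq_nonneg`), so the
derivative is `≥ −Σ 8/(x_k − x_j)⁴ ≥ −Σ_{k ∈ K, j ∉ K} 8/(x_k − x_j)⁴`; integrate
(`window_cross_energy_inequality`) and let the window exhaust `ℤ* ∖ K` ("monotone convergence").
[cite: RodgersTaoFMP2020, Lemma 12 (ii) p. 30] -/
theorem rodgers_tao_cross_energy_inequality_holds : rodgers_tao_cross_energy_inequality := by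
  intro K hK t₁ t₂ hΛ₁ h12
  obtain ⟨t₀, h01, hreal⟩ := hΛ₁
  have hΛ : ∀ t ∈ Icc t₁ t₂, ∃ t' : ℝ, t' < t ∧ HasOnlyRealZeros (deBruijnH t') := fun t ht ↦
    ⟨t₀, lt_of_lt_of_le h01 ht.1, hreal⟩
  have ht₁ : t₁ ∈ Icc t₁ t₂ := left_mem_Icc.2 h12.le
  have ht₂ : t₂ ∈ Icc t₁ t₂ := right_mem_Icc.2 h12.le
  refine ⟨fun t ht k _ ↦ ⟨(summable_interactionEnergy_int (hΛ t ht) k).subtype _,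
    (summable_div_sub_pow_four_int (hΛ t ht) k).subtype _⟩,
    (continuousOn_sum_tsum_div_sub_pow_four hreal h01 K).intervalIntegrable_of_Icc h12.le, ?_⟩
  -- the windows `W_R` eventually contain `K`
  set R₀ : ℕ := ∑ k ∈ K, k.natAbs with hR₀
  have hKW : ∀ R, R₀ ≤ R → K ⊆ zstarIcc (-(R : ℤ)) R := by
    intro R hR k hk
    have h1 : k.natAbs ≤ R₀ :=
      Finset.single_le_sum (f := fun k : ℤ ↦ k.natAbs) (fun i _ ↦ Nat.zero_le _) hk
    rw [mem_zstarIcc]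
    exact ⟨fun h ↦ hK (h ▸ hk), by omega, by omega⟩
  -- the right-hand sides of the truncated inequalities converge
  have hlim : Tendsto (fun R : ℕ ↦ ∑ k ∈ K, ∑ j ∈ zstarIcc (-(R : ℤ)) R \ K,
      (interactionEnergy t₂ j k - interactionEnergy t₁ j k)) atTop
      (𝓝 (∑ k ∈ K, ∑' j : zstarCompl K, (interactionEnergy t₂ j k - interactionEnergy t₁ j k))) :=
    tendsto_finsetSum _ fun k _ ↦ tendsto_sum_window_sdiff
      ((summable_interactionEnergy_int (hΛ t₂ ht₂) k).sub
        (summable_interactionEnergy_int (hΛ t₁ ht₁) k)) K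
  refine ge_of_tendsto hlim ?_
  filter_upwards [eventually_ge_atTop R₀] with R hR
  exact window_cross_energy_inequality hreal h01 h12.le hK (hKW R hR)

end Literature.NumberTheory.LFunctions

end
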